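import Literature.NumberTheory.LFunctions.CriticalLineTwoThirdsArchProofs
import Literature.NumberTheory.LFunctions.CriticalLineTwoThirdsSpectralInputs
import HarnessLib

/-!
# RH-FREE — «nothing here bears on the truth of RH»: Alpöge–Furman 2026 (arXiv:2608.13637) Proposition 5.4 (the prime term `𝓜[P_X,P_X]`) for the typed model of Theorem 5.7 — PROVED to precision `O(TL²)`, with the off-diagonal (`𝒪₁`) handled by the tree's Montgomery–Vaughan bilinear inequality (Lemma 2.2)

Topic `Literature/NumberTheory/LFunctions` (namespace `Literature.NumberTheory.LFunctions.AlpogeFurman2026`).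
Cell `rh-columns/lit`, unit `rh-lit-frontier-1` (gen 8). Source: **[AF26]** L. Alpöge, R. Furman,
*More than two thirds of the zeros of the Riemann zeta function are simple and on the critical
line*, arXiv:2608.13637v2 (19 Aug 2026), UNREFEREED preprint (D-0012); locators = printed
equation / proposition numbers and pages of v2. NO claim, NO `sorry`, no new named fact: every
statement below is a `theorem` (or a `def` with a body: the source's own auxiliary objects
`Φ(x)²e^{ixy}`, its primitive, `K_y(τ′)`, the weights `c_n = −Λ(n)/(π√n)` and the oscillatory
`τ′`-integrals `W_n(w)`), proved from Mathlib and the companion files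
`CriticalLineTwoThirdsArchProofs` (`formB = 𝓜[·,·]` and its bilinearity, `gConv = g = φ²⋆φ²`,
(5.12) `integral_PhiR_sq_mul_cos`, `integral_sub_setIntegral_Ioc`, `integrable_PhiR_sq`),
`CriticalLineTwoThirdsSpectralInputs` (**Lemma 2.2 with (2.9)**, `AlpogeFurman2026_MV_bilinear_log`,
PROVED there), `CriticalLineTwoThirdsReduction` (`sum_vonMangoldt_div_sqrt_le`,
`integral_lorentz_sq_mul_self`), `CriticalLineTwoThirdsPrimeSideSetup` (`PhiR = Φ`, the majorant
`lorentz`, `exists_majorant`, `setIntegral_lorentz_sq_le`), `CriticalLineTwoThirdsExplicitFormula`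
(`primeDensity = P_X`).

## What the source prints (Proposition 5.4 and its proof, p. 10)

"**Proposition 5.4** (Prime term). `𝓜[P_X,P_X] = (T/π) Σ_{n≤X} (Λ(n)²/n) g(log n) + O_χ(L²X)`,
`g := φ² ⋆ φ²`." Proof: "Write `P_X(τ) = −(1/2π)Σ_n a_n(n^{iτ} + n^{−iτ})`. Then
`P_X(τ)P_X(τ′) = (1/2π²) Re Σ_{n,m} a_na_m[n^{iτ}m^{−iτ′} + n^{iτ}m^{iτ′}]`. Substituting `τ = τ′ + x`
… (5.13) `𝓜[P_X,P_X] = (1/2π²) Re Σ_{n,m} a_na_m ∫_{−T}^{T} Φ(x)²n^{ix}[∫_{T+x⁻}^{2T−x⁺}(n/m)^{iτ′}dτ′ +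
∫_{T+x⁻}^{2T−x⁺}(nm)^{iτ′}dτ′]dx =: 𝒟 + 𝒪₁ + 𝒪₂`"; "`𝒟 = (T/π)Σ_n a_n² g(y_n) + O(L² log L)`" (by
(5.12) and "`∫_{|x|>T}Φ² ≤ ∫Φ²|x|/T`"); "`|𝒪₂| ≤ (1/2π²)(Σ_n a_n)²·2πbL·2/log 4 ≪ XL`";
"`𝒪₁ = (1/2π²) Re Σ_{n≠m} (a_na_m/(i(y_n−y_m)))[(n/m)^{2iT}(α_m^+ + α_n^-) − (n/m)^{iT}(α_n^+ + α_m^-)]`",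
"`α_n^± := ∫_0^{±T}Φ(x)²n^{ix}dx`, `|α_n^±| ≤ πbL`", "By Lemma 2.2 and (2.9) each of the four is at most
`(3π/2)·πL·Σ_n a_n²/δ_n ≪ L²X`. Hence `|𝒪₁| ≪ L²X`."

## What is here (typed model: `φ_T = χχ√ψ(·/L)`, `X = T/2π`, `I = [T,2T]`), and where it deviates

* §P1 `gE ψ T y x = Φ(x)²e^{ixy}`, its primitive `GE`, the kernel `KE ψ T y τ′ = K_y(τ′) =
  ∫_{T−τ′}^{2T−τ′}Φ(x)²e^{ixy}dx` (`KE_eq`, `hasDerivAt_KE`, `|K_y| ≤ ∫Φ²`), and the inner integral in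
  complex form `∫_I Φ(τ−τ′)²cos(τy)dτ = Re(e^{iτ′y}K_y(τ′))` (`inner_cos_eq_re`: the substitution
  `τ = τ′ + x` organised with `τ′` OUTSIDE — the deviation that keeps everything a product of
  one-index quantities).
* §P2 the EXACT `τ′`-integral for `w ≠ 0` by one integration by parts and the two substitutions
  `x = T − τ′`, `x = 2T − τ′` (`integral_KE_mul_phase`):
  `∫_I K_y e^{iτ′w} = (1/(iw))[e^{2iTw}(α⁻_y + α⁺_{y−w}) − e^{iTw}(α⁺_y + α⁻_{y−w})]` — with `y = log n`,
  `w = log n − log m` this is the printed `𝒪₁` display (`y − w = log m`); and `|·| ≤ 4∫Φ²/|w|`.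
* §P3 the `w = 0` integral `∫_I K_y = T∫_{−T}^{T}Φ²e^{ixy} + ∫_{−T}^0 xΦ²e^{ixy} − ∫_0^T xΦ²e^{ixy}`
  (`integral_KE_eq`) and **`|Re∫_I K_y − 2πT g(y)| ≤ 8A²/(3T²) + 4AM`** (`re_integral_KE_sub_le`; (5.12),
  tails `∫_{|x|>T}Φ² ≤ 8A²/(3T³)`, `∫|x|Φ² ≤ 4AM`).
* §P4 (5.13) for one pair: `𝓜[cos(·y_n),cos(·y_m)] = ½Re W_n(y_n+y_m) + ½Re W_n(y_n−y_m)`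
  (`formB_cos_cos_eq`).
* §P5 bilinearity of `𝓜` over finite sums, `P_X` as a sum over `1 ≤ n ≤ ⌊X⌋`, the Chebyshev inputs
  `Σa_n ≤ 2(log 4+4)√X`, `Σa_n² ≤ (log 4+4)LX`, `ΣΛ(n)² ≤ (log 4+4)LX` (from `Λ(n) ≤ log n ≤ L` and
  Mathlib's `ψ(x) ≤ (log 4+4)x`; cruder than the printed `Σa_n² ≪ L²` but within budget), and the
  tree's Montgomery–Vaughan inequality re-indexed to `[1, N]` (`MV_Icc`); the `𝒪₁` bound
  `‖Σ_{n≠m} c_nc_m W_n(log n − log m)‖ ≤ 12π∫Φ²·Σ n c_n²` (`offdiag_le`: four MV sums).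
* §P6 **`AlpogeFurman2026_prime_term`**: for a window `ψ` there is `C ≥ 0` with
  `|𝓜[P_X,P_X] − (T/π)Σ_{1≤n≤X}(Λ(n)²/n)g(log n)| ≤ C·T·L²` for all `T ≥ 300`, `L ≥ 10`.

DEVIATIONS (recorded, no endorsement either way): the error is stated as `C·T·L²` (`X = T/2π`),
which is what the typed Theorem 5.7 consumes; constants are cruder than printed (`Θ₀ ≍ √L`,
`Σa_n² ≪ LX` in place of `≪ L²`); the `τ′`-first organisation of (5.13) replaces the printed
Fubini over the region `τ′ ∈ I ∩ (I − x)`.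

STATUS NOTE (no endorsement). Elementary real/complex analysis and the tree's (proved) Montgomery–
Vaughan inequality on the source's auxiliary objects; nothing here asserts Theorem 5.7, Theorem A, or
RH. What remains for the typed Theorem 5.7 after this file and `CriticalLineTwoThirdsArchProofs`:
the evaluation `Σ_{n≤X}(Λ(n)²/n)g(log n) = (L³/2)∬|u−v|ψψ + O(L²)` (partial summation with the tree's
`AlpogeFurman2026_sum_vonMangoldt_sq_div`) and the assembly with `AlpogeFurman2026_reduction`,
`AlpogeFurman2026_trace_sq_perturbation`. [AF26] is an unrefereed preprint.

## References
* [AlpogeFurman2026] as above: Proposition 5.4 and its proof, eq. (5.13) (p. 10); Lemma 2.2 and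
  eq. (2.9) (p. 5); Lemma 5.1 eq. (5.4) (p. 7); §5.3 eq. (5.12) (p. 9).
* [MontgomeryVaughan1974] H. L. Montgomery, R. C. Vaughan, *Hilbert's inequality*, J. London Math.
  Soc. (2) 8 (1974) — via the tree's `AlpogeFurman2026_MV_bilinear_log`.
-/

noncomputable section

open Complex Filter Set MeasureTheory
open scoped Real Topology ComplexConjugate ArithmeticFunction.vonMangoldt

namespace Literature.NumberTheory.LFunctions

namespace AlpogeFurman2026

variable {ψ : ℝ → ℝ}

/-! ## §P1. The complex kernel `Φ(x)² e^{ixy}`, its primitive, and `K_y(τ′) = ∫_{T−τ′}^{2T−τ′} Φ(x)² e^{ixy} dx` -/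

/-- `Φ_T(x)² e^{ixy}` (the integrand of `α_n^± = ∫ Φ(x)² n^{ix} dx`, `y = log n`).
[cite: AlpogeFurman2026, Proposition 5.4 (proof: "`α_n^+ := ∫_0^T Φ(x)² n^{ix} dx`"), p. 10] -/
def gE (ψ : ℝ → ℝ) (T y x : ℝ) : ℂ := ((PhiR ψ T x ^ 2 : ℝ) : ℂ) * cexp (((x * y : ℝ) : ℂ) * I)

/-- `x ↦ Φ(x)² e^{ixy}` is continuous. [cite: AlpogeFurman2026, Proposition 5.4 (proof), p. 10] -/
theorem continuous_gE (hψ : IsWindow ψ) (T y : ℝ) : Continuous (gE ψ T y) := by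
  unfold gE
  exact (Complex.continuous_ofReal.comp ((continuous_hatR hψ T).2.pow 2)).mul (by fun_prop)

/-- `|Φ(x)² e^{ixy}| = Φ(x)²`. [cite: AlpogeFurman2026, Proposition 5.4 (proof), p. 10] -/
theorem norm_gE (ψ : ℝ → ℝ) (T y x : ℝ) : ‖gE ψ T y x‖ = PhiR ψ T x ^ 2 := by
  rw [gE, norm_mul, Complex.norm_real, Complex.norm_exp_ofReal_mul_I, mul_one, Real.norm_eq_abs,
    abs_of_nonneg (sq_nonneg _)]

/-- `|∫_a^b Φ(x)² e^{ixy} dx| ≤ ∫_ℝ Φ²` (`a ≤ b`): the printed "`|α_n^±| ≤ πbL`".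
[cite: AlpogeFurman2026, Proposition 5.4 (proof: "`|α_n^±| ≤ πbL ≤ πL`"), p. 10] -/
theorem norm_integral_gE_le (hψ : IsWindow ψ) {T : ℝ} (hL : 1 ≤ logHeight T) (y : ℝ) {a b : ℝ}
    (hab : a ≤ b) : ‖∫ x in a..b, gE ψ T y x‖ ≤ ∫ x, PhiR ψ T x ^ 2 := by
  calc ‖∫ x in a..b, gE ψ T y x‖ ≤ ∫ x in a..b, ‖gE ψ T y x‖ :=
        intervalIntegral.norm_integral_le_integral_norm hab
    _ = ∫ x in a..b, PhiR ψ T x ^ 2 := by simp_rw [norm_gE]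
    _ ≤ ∫ x, PhiR ψ T x ^ 2 := by
        rw [intervalIntegral.integral_of_le hab]
        exact setIntegral_le_integral (integrable_PhiR_sq hψ hL)
          (Eventually.of_forall fun x ↦ sq_nonneg _)

/-- The primitive `G_y(s) := ∫_0^s Φ(x)² e^{ixy} dx`. [cite: AlpogeFurman2026, Proposition 5.4 (proof), p. 10] -/
def GE (ψ : ℝ → ℝ) (T y s : ℝ) : ℂ := ∫ x in (0 : ℝ)..s, gE ψ T y x

/-- `G_y′ = Φ² e^{i·y}` (fundamental theorem of calculus). [cite: AlpogeFurman2026, Proposition 5.4 (proof), p. 10] -/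
theorem hasDerivAt_GE (hψ : IsWindow ψ) (T y s : ℝ) : HasDerivAt (GE ψ T y) (gE ψ T y s) s :=
  ((continuous_gE hψ T y).integral_hasStrictDerivAt 0 s).hasDerivAt

/-- **`K_y(τ′) := ∫_{T−τ′}^{2T−τ′} Φ(x)² e^{ixy} dx`** (written through the primitive), so that
`∫_I Φ(τ−τ′)² cos(τy) dτ = Re(e^{iτ′y} K_y(τ′))` (`inner_cos_eq_re`): the substitution
`τ = τ′ + x`, "`τ′` ranges over `I ∩ (I − x)`" of the printed proof, organised with `τ′` outside.
[cite: AlpogeFurman2026, Proposition 5.4 (proof: "Substituting `τ = τ′ + x` …"), p. 10] -/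
def KE (ψ : ℝ → ℝ) (T y τ' : ℝ) : ℂ := GE ψ T y (2 * T - τ') - GE ψ T y (T - τ')

/-- `K_y(τ′) = ∫_{T−τ′}^{2T−τ′} Φ(x)² e^{ixy} dx`. [cite: AlpogeFurman2026, Proposition 5.4 (proof), p. 10] -/
theorem KE_eq (hψ : IsWindow ψ) (T y τ' : ℝ) :
    KE ψ T y τ' = ∫ x in (T - τ')..(2 * T - τ'), gE ψ T y x := by
  rw [KE, GE, GE]
  exact intervalIntegral.integral_interval_sub_left ((continuous_gE hψ T y).intervalIntegrable _ _)
    ((continuous_gE hψ T y).intervalIntegrable _ _)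

/-- `K_y′(τ′) = Φ(T−τ′)²e^{i(T−τ′)y} − Φ(2T−τ′)²e^{i(2T−τ′)y}`. [cite: AlpogeFurman2026, Proposition 5.4 (proof), p. 10] -/
theorem hasDerivAt_KE (hψ : IsWindow ψ) (T y τ' : ℝ) :
    HasDerivAt (KE ψ T y) (gE ψ T y (T - τ') - gE ψ T y (2 * T - τ')) τ' := by
  have hlin : ∀ a t : ℝ, HasDerivAt (fun t ↦ a - t) (-1) t := fun a t ↦ by
    simpa using (hasDerivAt_id t).const_sub a
  have h1 := (hasDerivAt_GE hψ T y (2 * T - τ')).scomp τ' (hlin (2 * T) τ')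
  have h2 := (hasDerivAt_GE hψ T y (T - τ')).scomp τ' (hlin T τ')
  have h := h1.sub h2
  have e : (-1 : ℝ) • gE ψ T y (2 * T - τ') - (-1 : ℝ) • gE ψ T y (T - τ') =
      gE ψ T y (T - τ') - gE ψ T y (2 * T - τ') := by
    rw [neg_one_smul, neg_one_smul]; ring
  exact h.congr_deriv e

/-- `K_y` is continuous. [cite: AlpogeFurman2026, Proposition 5.4 (proof), p. 10] -/
theorem continuous_KE (hψ : IsWindow ψ) (T y : ℝ) : Continuous (KE ψ T y) :=
  continuous_iff_continuousAt.2 fun t ↦ (hasDerivAt_KE hψ T y t).continuousAt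

/-- `|K_y(τ′)| ≤ ∫Φ²` (`T > 0`). [cite: AlpogeFurman2026, Proposition 5.4 (proof), p. 10] -/
theorem norm_KE_le (hψ : IsWindow ψ) {T : ℝ} (hT : 0 < T) (hL : 1 ≤ logHeight T) (y τ' : ℝ) :
    ‖KE ψ T y τ'‖ ≤ ∫ x, PhiR ψ T x ^ 2 := by
  rw [KE_eq hψ]
  exact norm_integral_gE_le hψ hL y (by linarith)

/-- `e^{iθ} · Φ(x)² e^{ixy} = Φ²cos(xy+θ) + i Φ² sin(xy+θ)`. [cite: AlpogeFurman2026, Proposition 5.4 (proof), p. 10] -/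
theorem phase_mul_gE (ψ : ℝ → ℝ) (T y x θ : ℝ) :
    cexp (((θ : ℝ) : ℂ) * I) * gE ψ T y x =
      ((PhiR ψ T x ^ 2 * Real.cos (x * y + θ) : ℝ) : ℂ) +
        ((PhiR ψ T x ^ 2 * Real.sin (x * y + θ) : ℝ) : ℂ) * I := by
  rw [gE, mul_left_comm, ← Complex.exp_add, ← add_mul, ← Complex.ofReal_add, add_comm θ,
    Complex.exp_mul_I, ← Complex.ofReal_cos, ← Complex.ofReal_sin]
  push_cast
  ring

/-- **The inner integral in complex form**: `∫_I Φ(τ−τ′)² cos(τy) dτ = Re(e^{iτ′y} K_y(τ′))`.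
[cite: AlpogeFurman2026, Proposition 5.4 (proof: "Substituting `τ = τ′ + x` …"), p. 10] -/
theorem inner_cos_eq_re (hψ : IsWindow ψ) (T y τ' : ℝ) :
    ∫ τ in T..2 * T, PhiR ψ T (τ - τ') ^ 2 * Real.cos (τ * y) =
      (cexp (((τ' * y : ℝ) : ℂ) * I) * KE ψ T y τ').re := by
  have hΦ := (continuous_hatR hψ T).2
  rw [KE_eq hψ, ← intervalIntegral.integral_const_mul]
  have h1 : ∫ τ in T..2 * T, PhiR ψ T (τ - τ') ^ 2 * Real.cos (τ * y) =
      ∫ x in (T - τ')..(2 * T - τ'), PhiR ψ T x ^ 2 * Real.cos (x * y + τ' * y) := by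
    rw [← intervalIntegral.integral_comp_sub_right (fun x ↦ PhiR ψ T x ^ 2 * Real.cos (x * y + τ' * y)) τ']
    refine intervalIntegral.integral_congr fun τ _ ↦ ?_
    rw [show (τ - τ') * y + τ' * y = τ * y by ring]
  rw [h1]
  simp_rw [phase_mul_gE]
  have hc1 : Continuous fun x : ℝ ↦ ((PhiR ψ T x ^ 2 * Real.cos (x * y + τ' * y) : ℝ) : ℂ) :=
    Complex.continuous_ofReal.comp ((hΦ.pow 2).mul (by fun_prop))
  have hc2 : Continuous fun x : ℝ ↦ ((PhiR ψ T x ^ 2 * Real.sin (x * y + τ' * y) : ℝ) : ℂ) * I :=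
    (Complex.continuous_ofReal.comp ((hΦ.pow 2).mul (by fun_prop))).mul continuous_const
  rw [intervalIntegral.integral_add (hc1.intervalIntegrable _ _) (hc2.intervalIntegrable _ _),
    intervalIntegral.integral_mul_const, intervalIntegral.integral_ofReal,
    intervalIntegral.integral_ofReal]
  simp

/-! ## §P2. The exact integration by parts `∫_I K_y(τ′) e^{iτ′w} dτ′` for `w ≠ 0` -/

/-- The phase `t ↦ e^{itw}` has derivative `iw·e^{itw}`. [folklore] -/
private theorem hasDerivAt_phase (w t : ℝ) :
    HasDerivAt (fun t : ℝ ↦ cexp (((t * w : ℝ) : ℂ) * I)) (cexp (((t * w : ℝ) : ℂ) * I) * ((w : ℂ) * I)) t := by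
  have h1 : HasDerivAt (fun t : ℝ ↦ ((t * w : ℝ) : ℂ) * I) ((w : ℂ) * I) t := by
    have h := ((hasDerivAt_mul_const w (x := t)).ofReal_comp).mul_const I
    simpa using h
  exact h1.cexp

/-- **Change of variables `x = T − τ′`**: `∫_T^{2T} Φ(T−τ′)²e^{i(T−τ′)y} e^{iτ′w} dτ′
= e^{iTw} ∫_{−T}^0 Φ(x)² e^{ix(y−w)} dx` (the printed "`n^{ix}(n/m)^{ix⁻}` equals … `m^{ix}` for
`x < 0`"). [cite: AlpogeFurman2026, Proposition 5.4 (proof, the term `𝒪₁`), p. 10] -/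
theorem integral_gE_left_phase (ψ : ℝ → ℝ) (T y w : ℝ) :
    ∫ t in T..2 * T, gE ψ T y (T - t) * cexp (((t * w : ℝ) : ℂ) * I) =
      cexp (((T * w : ℝ) : ℂ) * I) * ∫ x in (-T)..0, gE ψ T (y - w) x := by
  have h := intervalIntegral.integral_comp_sub_left
    (fun x ↦ gE ψ T y x * cexp ((((T - x) * w : ℝ) : ℂ) * I)) (a := T) (b := 2 * T) T
  simp only [sub_sub_cancel] at h
  rw [h, show T - 2 * T = -T by ring, show T - T = (0 : ℝ) by ring, ← intervalIntegral.integral_const_mul]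
  refine intervalIntegral.integral_congr fun x _ ↦ ?_
  simp only [gE]
  rw [mul_assoc, ← Complex.exp_add, mul_left_comm, ← Complex.exp_add]
  congr 2
  push_cast
  ring

/-- **Change of variables `x = 2T − τ′`**: `∫_T^{2T} Φ(2T−τ′)²e^{i(2T−τ′)y} e^{iτ′w} dτ′
= e^{2iTw} ∫_0^T Φ(x)² e^{ix(y−w)} dx`. [cite: AlpogeFurman2026, Proposition 5.4 (proof, the term `𝒪₁`), p. 10] -/
theorem integral_gE_right_phase (ψ : ℝ → ℝ) (T y w : ℝ) :
    ∫ t in T..2 * T, gE ψ T y (2 * T - t) * cexp (((t * w : ℝ) : ℂ) * I) =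
      cexp (((2 * T * w : ℝ) : ℂ) * I) * ∫ x in (0 : ℝ)..T, gE ψ T (y - w) x := by
  have h := intervalIntegral.integral_comp_sub_left
    (fun x ↦ gE ψ T y x * cexp ((((2 * T - x) * w : ℝ) : ℂ) * I)) (a := T) (b := 2 * T) (2 * T)
  simp only [sub_sub_cancel] at h
  rw [h, show 2 * T - 2 * T = (0 : ℝ) by ring, show 2 * T - T = T by ring,
    ← intervalIntegral.integral_const_mul]
  refine intervalIntegral.integral_congr fun x _ ↦ ?_
  simp only [gE]
  rw [mul_assoc, ← Complex.exp_add, mul_left_comm, ← Complex.exp_add]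
  congr 2
  push_cast
  ring

/-- **The exact `τ′`-integral for `w ≠ 0`** (the printed evaluation of the first inner integral,
"`[(n/m)^{i(2T−x⁺)} − (n/m)^{i(T+x⁻)}]/(iϑ)`", organised as one integration by parts in `τ′`):
`∫_I K_y(τ′) e^{iτ′w} dτ′ = (1/(iw))·[e^{2iTw}(α⁻_y + α⁺_{y−w}) − e^{iTw}(α⁺_y + α⁻_{y−w})]`, where
`α⁺_v = ∫_0^T Φ(x)²e^{ixv}dx`, `α⁻_v = ∫_{−T}^0 Φ(x)²e^{ixv}dx`. With `y = log n`, `w = log n − log m`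
(`y − w = log m`) this is the printed
"`𝒪₁ = (1/2π²) Re Σ_{n≠m} (a_na_m/(i(y_n−y_m)))[(n/m)^{2iT}(α_m^+ + α_n^-) − (n/m)^{iT}(α_n^+ + α_m^-)]`".
[cite: AlpogeFurman2026, Proposition 5.4 (proof, display for `𝒪₁`), p. 10] -/
theorem integral_KE_mul_phase (hψ : IsWindow ψ) {T : ℝ} (hT : 0 < T) (y : ℝ) {w : ℝ} (hw : w ≠ 0) :
    ∫ t in T..2 * T, KE ψ T y t * cexp (((t * w : ℝ) : ℂ) * I) =
      1 / ((w : ℂ) * I) *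
        (cexp (((2 * T * w : ℝ) : ℂ) * I) *
            ((∫ x in (-T)..0, gE ψ T y x) + ∫ x in (0 : ℝ)..T, gE ψ T (y - w) x) -
          cexp (((T * w : ℝ) : ℂ) * I) *
            ((∫ x in (0 : ℝ)..T, gE ψ T y x) + ∫ x in (-T)..0, gE ψ T (y - w) x)) := by
  have hT2 : T ≤ 2 * T := by linarith
  have hwI : (w : ℂ) * I ≠ 0 := mul_ne_zero (Complex.ofReal_ne_zero.2 hw) Complex.I_ne_zero
  -- integration by parts
  have hu : ∀ t ∈ uIcc T (2 * T), HasDerivAt (KE ψ T y) (gE ψ T y (T - t) - gE ψ T y (2 * T - t)) t :=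
    fun t _ ↦ hasDerivAt_KE hψ T y t
  have hv : ∀ t ∈ uIcc T (2 * T), HasDerivAt (fun t : ℝ ↦ cexp (((t * w : ℝ) : ℂ) * I) / ((w : ℂ) * I))
      (cexp (((t * w : ℝ) : ℂ) * I)) t := by
    intro t _
    have h := (hasDerivAt_phase w t).div_const ((w : ℂ) * I)
    rwa [mul_div_assoc, div_self hwI, mul_one] at h
  have hgc := continuous_gE hψ T y
  have hu'c : Continuous fun t ↦ gE ψ T y (T - t) - gE ψ T y (2 * T - t) :=
    (hgc.comp (continuous_const.sub continuous_id)).sub (hgc.comp (continuous_const.sub continuous_id))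
  have hphc : Continuous fun t : ℝ ↦ cexp (((t * w : ℝ) : ℂ) * I) := by fun_prop
  rw [intervalIntegral.integral_mul_deriv_eq_deriv_mul hu hv (hu'c.intervalIntegrable _ _)
    (hphc.intervalIntegrable _ _)]
  -- boundary values
  have hK2 : KE ψ T y (2 * T) = ∫ x in (-T)..0, gE ψ T y x := by
    rw [KE_eq hψ, show T - 2 * T = -T by ring, show 2 * T - 2 * T = (0 : ℝ) by ring]
  have hK1 : KE ψ T y T = ∫ x in (0 : ℝ)..T, gE ψ T y x := by
    rw [KE_eq hψ, show T - T = (0 : ℝ) by ring, show 2 * T - T = T by ring]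
  -- the remaining integral
  have hrest : ∫ t in T..2 * T, (gE ψ T y (T - t) - gE ψ T y (2 * T - t)) *
      (cexp (((t * w : ℝ) : ℂ) * I) / ((w : ℂ) * I)) =
      1 / ((w : ℂ) * I) * (cexp (((T * w : ℝ) : ℂ) * I) * (∫ x in (-T)..0, gE ψ T (y - w) x) -
        cexp (((2 * T * w : ℝ) : ℂ) * I) * ∫ x in (0 : ℝ)..T, gE ψ T (y - w) x) := by
    have e : ∀ t : ℝ, (gE ψ T y (T - t) - gE ψ T y (2 * T - t)) * (cexp (((t * w : ℝ) : ℂ) * I) / ((w : ℂ) * I)) =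
        1 / ((w : ℂ) * I) * (gE ψ T y (T - t) * cexp (((t * w : ℝ) : ℂ) * I) -
          gE ψ T y (2 * T - t) * cexp (((t * w : ℝ) : ℂ) * I)) := fun t ↦ by
      field_simp
    simp_rw [e]
    have hiL : IntervalIntegrable (fun t : ℝ ↦ gE ψ T y (T - t) * cexp (((t * w : ℝ) : ℂ) * I)) volume T (2 * T) :=
      ((hgc.comp (continuous_const.sub continuous_id)).mul hphc).intervalIntegrable _ _
    have hiR : IntervalIntegrable (fun t : ℝ ↦ gE ψ T y (2 * T - t) * cexp (((t * w : ℝ) : ℂ) * I)) volume T (2 * T) :=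
      ((hgc.comp (continuous_const.sub continuous_id)).mul hphc).intervalIntegrable _ _
    rw [intervalIntegral.integral_const_mul, intervalIntegral.integral_sub hiL hiR,
      integral_gE_left_phase ψ, integral_gE_right_phase ψ]
  rw [hrest, hK2, hK1, show ((2 * T) * w : ℝ) = 2 * T * w by ring]
  field_simp
  ring

/-- **The bound for `w ≠ 0`**: `|∫_I K_y(τ′)e^{iτ′w}dτ′| ≤ 4∫Φ²/|w|` (`|α^±| ≤ ∫Φ²`).
[cite: AlpogeFurman2026, Proposition 5.4 (proof: "`|α_n^±| ≤ πbL`" and the bound for `𝒪₂`), p. 10] -/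
theorem norm_integral_KE_mul_phase_le (hψ : IsWindow ψ) {T : ℝ} (hT : 0 < T) (hL : 1 ≤ logHeight T)
    (y : ℝ) {w : ℝ} (hw : w ≠ 0) :
    ‖∫ t in T..2 * T, KE ψ T y t * cexp (((t * w : ℝ) : ℂ) * I)‖ ≤ 4 * (∫ x, PhiR ψ T x ^ 2) / |w| := by
  set F := ∫ x, PhiR ψ T x ^ 2 with hF
  have hT0 : (0 : ℝ) ≤ T := hT.le
  rw [integral_KE_mul_phase hψ hT y hw]
  have h1 := norm_integral_gE_le hψ hL y (show -T ≤ 0 by linarith)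
  have h2 := norm_integral_gE_le hψ hL (y - w) hT0
  have h3 := norm_integral_gE_le hψ hL y hT0
  have h4 := norm_integral_gE_le hψ hL (y - w) (show -T ≤ 0 by linarith)
  rw [← hF] at h1 h2 h3 h4
  have hwn : ‖1 / ((w : ℂ) * I)‖ = 1 / |w| := by
    rw [norm_div, norm_one, norm_mul, Complex.norm_real, Complex.norm_I, mul_one, Real.norm_eq_abs]
  have he2 : ‖cexp (((2 * T * w : ℝ) : ℂ) * I)‖ = 1 := Complex.norm_exp_ofReal_mul_I _
  have he1 : ‖cexp (((T * w : ℝ) : ℂ) * I)‖ = 1 := Complex.norm_exp_ofReal_mul_I _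
  rw [norm_mul, hwn]
  have hA : ‖cexp (((2 * T * w : ℝ) : ℂ) * I) *
        ((∫ x in (-T)..0, gE ψ T y x) + ∫ x in (0 : ℝ)..T, gE ψ T (y - w) x)‖ ≤ F + F := by
    rw [norm_mul, he2, one_mul]
    exact (norm_add_le _ _).trans (add_le_add h1 h2)
  have hB : ‖cexp (((T * w : ℝ) : ℂ) * I) *
        ((∫ x in (0 : ℝ)..T, gE ψ T y x) + ∫ x in (-T)..0, gE ψ T (y - w) x)‖ ≤ F + F := by
    rw [norm_mul, he1, one_mul]
    exact (norm_add_le _ _).trans (add_le_add h3 h4)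
  have hw0 : 0 < |w| := abs_pos.2 hw
  calc 1 / |w| * ‖cexp (((2 * T * w : ℝ) : ℂ) * I) *
          ((∫ x in (-T)..0, gE ψ T y x) + ∫ x in (0 : ℝ)..T, gE ψ T (y - w) x) -
        cexp (((T * w : ℝ) : ℂ) * I) *
          ((∫ x in (0 : ℝ)..T, gE ψ T y x) + ∫ x in (-T)..0, gE ψ T (y - w) x)‖
      ≤ 1 / |w| * ((F + F) + (F + F)) := by
        refine mul_le_mul_of_nonneg_left ((norm_sub_le _ _).trans (add_le_add hA hB)) (by positivity)
    _ = 4 * F / |w| := by field_simp; ring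

/-! ## §P3. The diagonal `τ′`-integral `∫_I K_y(τ′) dτ′` (`w = 0`) -/

/-- **The exact `τ′`-integral for `w = 0`**: `∫_I K_y(τ′)dτ′ = T∫_{−T}^{T}Φ(x)²e^{ixy}dx +
∫_{−T}^0 xΦ(x)²e^{ixy}dx − ∫_0^T xΦ(x)²e^{ixy}dx` (i.e. `∫_{−T}^{T}(T − |x|)Φ(x)²e^{ixy}dx`: "for
`n = m` the first inner integral is `T − |x|`"). [cite: AlpogeFurman2026, Proposition 5.4 (proof, the term `𝒟`), p. 10] -/
theorem integral_KE_eq (hψ : IsWindow ψ) {T : ℝ} (hT : 0 < T) (y : ℝ) :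
    ∫ t in T..2 * T, KE ψ T y t =
      (T : ℂ) * (∫ x in (-T)..T, gE ψ T y x) + (∫ x in (-T)..0, (x : ℂ) * gE ψ T y x) -
        ∫ x in (0 : ℝ)..T, (x : ℂ) * gE ψ T y x := by
  have hT2 : T ≤ 2 * T := by linarith
  have hgc := continuous_gE hψ T y
  -- integration by parts against `v(t) = t − 2T`
  have hu : ∀ t ∈ uIcc T (2 * T), HasDerivAt (KE ψ T y) (gE ψ T y (T - t) - gE ψ T y (2 * T - t)) t :=
    fun t _ ↦ hasDerivAt_KE hψ T y t
  have hv : ∀ t ∈ uIcc T (2 * T), HasDerivAt (fun t : ℝ ↦ ((t : ℂ) - 2 * T)) 1 t := by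
    intro t _
    have h := (hasDerivAt_id t).ofReal_comp.sub_const (2 * (T : ℂ))
    simpa using h
  have hu'c : Continuous fun t ↦ gE ψ T y (T - t) - gE ψ T y (2 * T - t) :=
    (hgc.comp (continuous_const.sub continuous_id)).sub (hgc.comp (continuous_const.sub continuous_id))
  have h1c : Continuous fun _ : ℝ ↦ (1 : ℂ) := continuous_const
  have hibp := intervalIntegral.integral_mul_deriv_eq_deriv_mul hu hv (hu'c.intervalIntegrable _ _)
    (h1c.intervalIntegrable _ _)
  simp only [mul_one] at hibp
  rw [hibp]
  have hK1 : KE ψ T y T = ∫ x in (0 : ℝ)..T, gE ψ T y x := by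
    rw [KE_eq hψ, show T - T = (0 : ℝ) by ring, show 2 * T - T = T by ring]
  -- the remaining integral, by the substitutions `x = T − t`, `x = 2T − t`
  have hL : ∫ t in T..2 * T, gE ψ T y (T - t) * ((t : ℂ) - 2 * T) =
      -(T : ℂ) * (∫ x in (-T)..0, gE ψ T y x) - ∫ x in (-T)..0, (x : ℂ) * gE ψ T y x := by
    have h := intervalIntegral.integral_comp_sub_left
      (fun x ↦ gE ψ T y x * (((T - x : ℝ) : ℂ) - 2 * T)) (a := T) (b := 2 * T) T
    simp only [sub_sub_cancel] at h
    rw [h, show T - 2 * T = -T by ring, show T - T = (0 : ℝ) by ring]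
    have e : ∀ x : ℝ, gE ψ T y x * (((T - x : ℝ) : ℂ) - 2 * T) =
        -(T : ℂ) * gE ψ T y x - (x : ℂ) * gE ψ T y x := fun x ↦ by push_cast; ring
    simp_rw [e]
    have hi1 : IntervalIntegrable (fun x : ℝ ↦ -(T : ℂ) * gE ψ T y x) volume (-T) 0 :=
      (continuous_const.mul hgc).intervalIntegrable _ _
    have hi2 : IntervalIntegrable (fun x : ℝ ↦ (x : ℂ) * gE ψ T y x) volume (-T) 0 :=
      (Complex.continuous_ofReal.mul hgc).intervalIntegrable _ _
    rw [intervalIntegral.integral_sub hi1 hi2, intervalIntegral.integral_const_mul]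
  have hR : ∫ t in T..2 * T, gE ψ T y (2 * T - t) * ((t : ℂ) - 2 * T) =
      -∫ x in (0 : ℝ)..T, (x : ℂ) * gE ψ T y x := by
    have h := intervalIntegral.integral_comp_sub_left
      (fun x ↦ gE ψ T y x * (((2 * T - x : ℝ) : ℂ) - 2 * T)) (a := T) (b := 2 * T) (2 * T)
    simp only [sub_sub_cancel] at h
    rw [h, show 2 * T - 2 * T = (0 : ℝ) by ring, show 2 * T - T = T by ring,
      ← intervalIntegral.integral_neg]
    refine intervalIntegral.integral_congr fun x _ ↦ ?_
    push_cast
    ring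
  have hsplit : ∫ t in T..2 * T, (gE ψ T y (T - t) - gE ψ T y (2 * T - t)) * ((t : ℂ) - 2 * T) =
      (∫ t in T..2 * T, gE ψ T y (T - t) * ((t : ℂ) - 2 * T)) -
        ∫ t in T..2 * T, gE ψ T y (2 * T - t) * ((t : ℂ) - 2 * T) := by
    have hlc : Continuous fun t : ℝ ↦ ((t : ℂ) - 2 * T) := by fun_prop
    have hi1 : IntervalIntegrable (fun t : ℝ ↦ gE ψ T y (T - t) * ((t : ℂ) - 2 * T)) volume T (2 * T) :=
      ((hgc.comp (continuous_const.sub continuous_id)).mul hlc).intervalIntegrable _ _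
    have hi2 : IntervalIntegrable (fun t : ℝ ↦ gE ψ T y (2 * T - t) * ((t : ℂ) - 2 * T)) volume T (2 * T) :=
      ((hgc.comp (continuous_const.sub continuous_id)).mul hlc).intervalIntegrable _ _
    rw [← intervalIntegral.integral_sub hi1 hi2]
    refine intervalIntegral.integral_congr fun t _ ↦ ?_
    ring
  have hadj : ∫ x in (-T)..T, gE ψ T y x = (∫ x in (-T)..0, gE ψ T y x) + ∫ x in (0 : ℝ)..T, gE ψ T y x :=
    (intervalIntegral.integral_add_adjacent_intervals (hgc.intervalIntegrable _ _)
      (hgc.intervalIntegrable _ _)).symm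
  rw [hsplit, hL, hR, hK1, hadj]
  push_cast
  ring

/-- **Tails of `Φ²` at distance `c > 0`**: `∫_{x>c}Φ² ≤ 4A²/(3c³)`, `∫_{x<−c}Φ² ≤ 4A²/(3c³)`.
[cite: AlpogeFurman2026, Proposition 5.4 (proof: "using `∫_{|x|>T}Φ² ≤ ∫Φ²|x|/T`"), p. 10] -/
theorem tail_PhiR_sq_le' (hψ : IsWindow ψ) {M A : ℝ} (hM : 0 < M) (hA : 0 < A) {T : ℝ}
    (hL : 1 ≤ logHeight T) (hmaj : ∀ x : ℝ, |PhiR ψ T x| ≤ lorentz M A x) {c : ℝ} (hc : 0 < c) :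
    (∫ x in Ioi c, PhiR ψ T x ^ 2) ≤ 4 * A ^ 2 / (3 * c ^ 3) ∧
      (∫ x in Iic (-c), PhiR ψ T x ^ 2) ≤ 4 * A ^ 2 / (3 * c ^ 3) := by
  obtain ⟨hint1, -, h1⟩ := setIntegral_lorentz_sq_le hM hA c
  have hΦi := integrable_PhiR_sq hψ hL
  have hpt : ∀ x : ℝ, PhiR ψ T x ^ 2 ≤ lorentz M A x ^ 2 := fun x ↦ by
    have := pow_le_pow_left₀ (abs_nonneg _) (hmaj x) 2
    rwa [sq_abs] at this
  have hright : (∫ x in Ioi c, PhiR ψ T x ^ 2) ≤ 4 * A ^ 2 / (3 * c ^ 3) :=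
    (setIntegral_mono_on hΦi.integrableOn hint1 measurableSet_Ioi fun x _ ↦ hpt x).trans (h1 hc)
  refine ⟨hright, ?_⟩
  have e : ∫ x in Iic (-c), PhiR ψ T x ^ 2 = ∫ x in Ioi c, PhiR ψ T (-x) ^ 2 :=
    (integral_comp_neg_Ioi c (fun x ↦ PhiR ψ T x ^ 2)).symm
  rw [e]
  simp_rw [PhiR_neg hψ.even]
  exact hright

/-- `∫_0^T x Φ(x)² dx ≤ 2A M` and `∫_{−T}^0 |x| Φ(x)² dx ≤ 2AM` (`|Φ| ≤ ϑ_{M,A}`, `∫_0^∞ rϑ² = 2AM`):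
the printed "`∫_ℝ Φ(x)²|x| dx ≪ log L`" with the tree's majorant.
[cite: AlpogeFurman2026, §5.3 (p. 9: "`∫_ℝ Φ(x)²|x|dx ≪ log L`") and Proposition 5.4 (proof), p. 10] -/
theorem integral_mul_PhiR_sq_le (hψ : IsWindow ψ) {M A : ℝ} (hM : 0 < M) (hA : 0 < A) {T : ℝ}
    (hT : 0 < T) (hmaj : ∀ x : ℝ, |PhiR ψ T x| ≤ lorentz M A x) :
    (∫ x in (0 : ℝ)..T, x * PhiR ψ T x ^ 2) ≤ 2 * A * M ∧
      (∫ x in (-T)..0, -x * PhiR ψ T x ^ 2) ≤ 2 * A * M := by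
  obtain ⟨hint, hval⟩ := integral_lorentz_sq_mul_self hM hA
  have hΦ := (continuous_hatR hψ T).2
  have hpt : ∀ x : ℝ, PhiR ψ T x ^ 2 ≤ lorentz M A x ^ 2 := fun x ↦ by
    have := pow_le_pow_left₀ (abs_nonneg _) (hmaj x) 2
    rwa [sq_abs] at this
  have h1 : (∫ x in (0 : ℝ)..T, x * PhiR ψ T x ^ 2) ≤ 2 * A * M := by
    rw [intervalIntegral.integral_of_le hT.le, ← hval]
    have hnn : 0 ≤ᵐ[volume.restrict (Ioi (0 : ℝ))] fun x ↦ lorentz M A x ^ 2 * x :=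
      (ae_restrict_iff' measurableSet_Ioi).2 (Eventually.of_forall fun x hx ↦
        mul_nonneg (sq_nonneg _) (le_of_lt hx))
    calc ∫ x in Ioc 0 T, x * PhiR ψ T x ^ 2 ≤ ∫ x in Ioc 0 T, lorentz M A x ^ 2 * x :=
          setIntegral_mono_on ((continuous_id.mul (hΦ.pow 2)).integrableOn_Icc.mono_set
            Ioc_subset_Icc_self) (hint.mono_set Ioc_subset_Ioi_self) measurableSet_Ioc
            fun x hx ↦ by rw [mul_comm]; exact mul_le_mul_of_nonneg_right (hpt x) hx.1.le
      _ ≤ ∫ x in Ioi 0, lorentz M A x ^ 2 * x :=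
          setIntegral_mono_set hint hnn Ioc_subset_Ioi_self.eventuallyLE
  have h2 : (∫ x in (-T)..0, -x * PhiR ψ T x ^ 2) = ∫ x in (0 : ℝ)..T, x * PhiR ψ T x ^ 2 := by
    have h := intervalIntegral.integral_comp_neg (fun x ↦ x * PhiR ψ T x ^ 2) (a := -T) (b := 0)
    simp only [neg_neg, neg_zero] at h
    rw [← h]
    refine intervalIntegral.integral_congr fun x _ ↦ ?_
    simp only [PhiR_neg hψ.even, neg_mul]
  exact ⟨h1, h2 ▸ h1⟩

/-- `Φ(x)²e^{ixy} = Φ²cos(xy) + iΦ²sin(xy)`. [cite: AlpogeFurman2026, Proposition 5.4 (proof), p. 10] -/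
theorem gE_eq (ψ : ℝ → ℝ) (T y x : ℝ) :
    gE ψ T y x = ((PhiR ψ T x ^ 2 * Real.cos (x * y) : ℝ) : ℂ) +
      ((PhiR ψ T x ^ 2 * Real.sin (x * y) : ℝ) : ℂ) * I := by
  have h := phase_mul_gE ψ T y x 0
  simp only [Complex.ofReal_zero, zero_mul, Complex.exp_zero, one_mul, add_zero] at h
  exact h

/-- `Re ∫_a^b Φ(x)²e^{ixy}dx = ∫_a^b Φ(x)²cos(xy)dx`. [cite: AlpogeFurman2026, Proposition 5.4 (proof), p. 10] -/
theorem re_integral_gE (hψ : IsWindow ψ) (T y a b : ℝ) :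
    (∫ x in a..b, gE ψ T y x).re = ∫ x in a..b, PhiR ψ T x ^ 2 * Real.cos (x * y) := by
  have hΦ := (continuous_hatR hψ T).2
  simp_rw [gE_eq]
  have hc1 : Continuous fun x : ℝ ↦ ((PhiR ψ T x ^ 2 * Real.cos (x * y) : ℝ) : ℂ) :=
    Complex.continuous_ofReal.comp ((hΦ.pow 2).mul (by fun_prop))
  have hc2 : Continuous fun x : ℝ ↦ ((PhiR ψ T x ^ 2 * Real.sin (x * y) : ℝ) : ℂ) * I :=
    (Complex.continuous_ofReal.comp ((hΦ.pow 2).mul (by fun_prop))).mul continuous_const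
  rw [intervalIntegral.integral_add (hc1.intervalIntegrable _ _) (hc2.intervalIntegrable _ _),
    intervalIntegral.integral_mul_const, intervalIntegral.integral_ofReal,
    intervalIntegral.integral_ofReal]
  simp

/-- **The diagonal evaluation**: `|Re ∫_I K_y(τ′)dτ′ − 2πT·g(y)| ≤ 8A²/(3T²) + 4AM` (`T ≥ 1`,
`|Φ| ≤ ϑ_{M,A}`): by `integral_KE_eq`, (5.12) `∫_ℝΦ²cos(xy) = 2πg(y)`, the tails
`∫_{|x|>T}Φ² ≤ 8A²/(3T³)` and `∫_{−T}^{T}|x|Φ² ≤ 4AM` — the printed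
"`𝒟 = (1/2π²)Σ a_n²(T·2πg(y_n) + O(∫Φ(x)²(|x| + T·1_{|x|>T})dx))`".
[cite: AlpogeFurman2026, Proposition 5.4 (proof, the term `𝒟`), p. 10] -/
theorem re_integral_KE_sub_le (hψ : IsWindow ψ) {M A : ℝ} (hM : 0 < M) (hA : 0 < A) {T : ℝ}
    (hT : 1 ≤ T) (hL : 1 ≤ logHeight T) (hmaj : ∀ x : ℝ, |PhiR ψ T x| ≤ lorentz M A x) (y : ℝ) :
    |(∫ t in T..2 * T, KE ψ T y t).re - 2 * π * T * gConv ψ T y| ≤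
      8 * A ^ 2 / (3 * T ^ 2) + 4 * A * M := by
  have hT0 : 0 < T := by linarith
  have hΦ := (continuous_hatR hψ T).2
  have hΦi := integrable_PhiR_sq hψ hL
  rw [integral_KE_eq hψ hT0 y, Complex.sub_re, Complex.add_re, Complex.re_ofReal_mul,
    re_integral_gE hψ]
  -- the main piece
  set f : ℝ → ℝ := fun x ↦ PhiR ψ T x ^ 2 * Real.cos (x * y) with hf
  have hfc : Continuous f := (hΦ.pow 2).mul (by fun_prop)
  have hfle : ∀ x, |f x| ≤ PhiR ψ T x ^ 2 := fun x ↦ by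
    rw [hf]; dsimp only; rw [abs_mul, abs_of_nonneg (sq_nonneg _)]
    exact mul_le_of_le_one_right (sq_nonneg _) (Real.abs_cos_le_one _)
  have hfi : Integrable f := hΦi.mono' hfc.aestronglyMeasurable
    (Eventually.of_forall fun x ↦ by rw [Real.norm_eq_abs]; exact hfle x)
  have hfull : ∫ x, f x = 2 * π * gConv ψ T y := integral_PhiR_sq_mul_cos hψ hL y
  have hsplit := integral_sub_setIntegral_Ioc hfi (show -T ≤ T by linarith)
  obtain ⟨ht1, ht2⟩ := tail_PhiR_sq_le' hψ hM hA hL hmaj hT0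
  have htail : |(∫ x, f x) - ∫ x in (-T)..T, f x| ≤ 8 * A ^ 2 / (3 * T ^ 3) := by
    rw [intervalIntegral.integral_of_le (by linarith), hsplit]
    have h1 : |∫ x in Iic (-T), f x| ≤ 4 * A ^ 2 / (3 * T ^ 3) := by
      refine (abs_integral_le_integral_abs).trans ((setIntegral_mono_on hfi.abs.integrableOn
        hΦi.integrableOn measurableSet_Iic fun x _ ↦ hfle x).trans ht2)
    have h2 : |∫ x in Ioi T, f x| ≤ 4 * A ^ 2 / (3 * T ^ 3) := by
      refine (abs_integral_le_integral_abs).trans ((setIntegral_mono_on hfi.abs.integrableOn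
        hΦi.integrableOn measurableSet_Ioi fun x _ ↦ hfle x).trans ht1)
    calc |(∫ x in Iic (-T), f x) + ∫ x in Ioi T, f x|
        ≤ |∫ x in Iic (-T), f x| + |∫ x in Ioi T, f x| := abs_add_le _ _
      _ ≤ 4 * A ^ 2 / (3 * T ^ 3) + 4 * A ^ 2 / (3 * T ^ 3) := add_le_add h1 h2
      _ = 8 * A ^ 2 / (3 * T ^ 3) := by ring
  -- the two weighted pieces
  obtain ⟨hw1, hw2⟩ := integral_mul_PhiR_sq_le hψ hM hA hT0 hmaj
  have hP2 : |(∫ x in (0 : ℝ)..T, (x : ℂ) * gE ψ T y x).re| ≤ 2 * A * M := by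
    refine (Complex.abs_re_le_norm _).trans ?_
    calc ‖∫ x in (0 : ℝ)..T, (x : ℂ) * gE ψ T y x‖ ≤ ∫ x in (0 : ℝ)..T, ‖(x : ℂ) * gE ψ T y x‖ :=
          intervalIntegral.norm_integral_le_integral_norm hT0.le
      _ = ∫ x in (0 : ℝ)..T, |x| * PhiR ψ T x ^ 2 := by
          refine intervalIntegral.integral_congr fun x _ ↦ ?_
          simp only [norm_mul, Complex.norm_real, Real.norm_eq_abs, norm_gE]
      _ = ∫ x in (0 : ℝ)..T, x * PhiR ψ T x ^ 2 := by
          refine intervalIntegral.integral_congr fun x hx ↦ ?_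
          rw [uIcc_of_le hT0.le] at hx
          simp only [abs_of_nonneg hx.1]
      _ ≤ 2 * A * M := hw1
  have hP1 : |(∫ x in (-T)..0, (x : ℂ) * gE ψ T y x).re| ≤ 2 * A * M := by
    refine (Complex.abs_re_le_norm _).trans ?_
    calc ‖∫ x in (-T)..0, (x : ℂ) * gE ψ T y x‖ ≤ ∫ x in (-T)..0, ‖(x : ℂ) * gE ψ T y x‖ :=
          intervalIntegral.norm_integral_le_integral_norm (by linarith)
      _ = ∫ x in (-T)..0, |x| * PhiR ψ T x ^ 2 := by
          refine intervalIntegral.integral_congr fun x _ ↦ ?_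
          simp only [norm_mul, Complex.norm_real, Real.norm_eq_abs, norm_gE]
      _ = ∫ x in (-T)..0, -x * PhiR ψ T x ^ 2 := by
          refine intervalIntegral.integral_congr fun x hx ↦ ?_
          rw [uIcc_of_le (by linarith)] at hx
          simp only [abs_of_nonpos hx.2]
      _ ≤ 2 * A * M := hw2
  -- assemble
  have e : T * (∫ x in (-T)..T, f x) + (∫ x in (-T)..0, (x : ℂ) * gE ψ T y x).re -
      (∫ x in (0 : ℝ)..T, (x : ℂ) * gE ψ T y x).re - 2 * π * T * gConv ψ T y =
      -(T * ((∫ x, f x) - ∫ x in (-T)..T, f x)) + (∫ x in (-T)..0, (x : ℂ) * gE ψ T y x).re -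
        (∫ x in (0 : ℝ)..T, (x : ℂ) * gE ψ T y x).re := by
    rw [hfull]; ring
  rw [e]
  have hTt : |T * ((∫ x, f x) - ∫ x in (-T)..T, f x)| ≤ 8 * A ^ 2 / (3 * T ^ 2) := by
    rw [abs_mul, abs_of_pos hT0]
    calc T * |(∫ x, f x) - ∫ x in (-T)..T, f x| ≤ T * (8 * A ^ 2 / (3 * T ^ 3)) :=
          mul_le_mul_of_nonneg_left htail hT0.le
      _ = 8 * A ^ 2 / (3 * T ^ 2) := by field_simp
  calc |-(T * ((∫ x, f x) - ∫ x in (-T)..T, f x)) + (∫ x in (-T)..0, (x : ℂ) * gE ψ T y x).re -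
        (∫ x in (0 : ℝ)..T, (x : ℂ) * gE ψ T y x).re|
      ≤ |-(T * ((∫ x, f x) - ∫ x in (-T)..T, f x))| + |(∫ x in (-T)..0, (x : ℂ) * gE ψ T y x).re| +
        |(∫ x in (0 : ℝ)..T, (x : ℂ) * gE ψ T y x).re| :=
        (abs_sub _ _).trans (add_le_add (abs_add_le _ _) le_rfl)
    _ ≤ 8 * A ^ 2 / (3 * T ^ 2) + 2 * A * M + 2 * A * M := by
        rw [abs_neg]; exact add_le_add (add_le_add hTt hP1) hP2
    _ = 8 * A ^ 2 / (3 * T ^ 2) + 4 * A * M := by ring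

/-! ## §P4. `𝓜[P_X,P_X]` as a double sum over frequencies -/

/-- The pair integral `B(n,m) := 𝓜[cos(·log n), cos(·log m)] = ∫_I cos(τ′y_m)∫_IΦ(τ−τ′)²cos(τy_n)`
splits into the sum- and difference-frequency pieces:
`B(n,m) = ½ Re ∫_I K_{y_n}(τ′)e^{iτ′(y_n+y_m)}dτ′ + ½ Re ∫_I K_{y_n}(τ′)e^{iτ′(y_n−y_m)}dτ′` — the
printed "`P_X(τ)P_X(τ′) = (1/2π²) Re Σ a_na_m[n^{iτ}m^{−iτ′} + n^{iτ}m^{iτ′}]`".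
[cite: AlpogeFurman2026, Proposition 5.4 (proof, eq. (5.13)), p. 10] -/
theorem formB_cos_cos_eq (hψ : IsWindow ψ) (T yn ym : ℝ) :
    formB ψ T (fun τ ↦ Real.cos (τ * yn)) (fun τ ↦ Real.cos (τ * ym)) =
      1 / 2 * (∫ t in T..2 * T, KE ψ T yn t * cexp (((t * (yn + ym) : ℝ) : ℂ) * I)).re +
        1 / 2 * (∫ t in T..2 * T, KE ψ T yn t * cexp (((t * (yn - ym) : ℝ) : ℂ) * I)).re := by
  unfold formB
  simp_rw [inner_cos_eq_re hψ]
  have hKc := continuous_KE hψ T yn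
  have e : ∀ t : ℝ, Real.cos (t * ym) * (cexp (((t * yn : ℝ) : ℂ) * I) * KE ψ T yn t).re =
      (1 / 2 * (KE ψ T yn t * cexp (((t * (yn + ym) : ℝ) : ℂ) * I)) +
        1 / 2 * (KE ψ T yn t * cexp (((t * (yn - ym) : ℝ) : ℂ) * I))).re := by
    intro t
    rw [← Complex.re_ofReal_mul]
    congr 1
    have hc : ((Real.cos (t * ym) : ℝ) : ℂ) =
        1 / 2 * (cexp (((t * ym : ℝ) : ℂ) * I) + cexp (-(((t * ym : ℝ) : ℂ) * I))) := by
      rw [Complex.ofReal_cos, Complex.cos]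
      ring_nf
    rw [hc]
    have e1 : cexp (((t * (yn + ym) : ℝ) : ℂ) * I) = cexp (((t * yn : ℝ) : ℂ) * I) * cexp (((t * ym : ℝ) : ℂ) * I) := by
      rw [← Complex.exp_add]; congr 1; push_cast; ring
    have e2 : cexp (((t * (yn - ym) : ℝ) : ℂ) * I) = cexp (((t * yn : ℝ) : ℂ) * I) * cexp (-(((t * ym : ℝ) : ℂ) * I)) := by
      rw [← Complex.exp_add]; congr 1; push_cast; ring
    rw [e1, e2]; ring
  simp_rw [e]
  have hph : ∀ w : ℝ, Continuous fun t : ℝ ↦ KE ψ T yn t * cexp (((t * w : ℝ) : ℂ) * I) :=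
    fun w ↦ hKc.mul (by fun_prop)
  have hi1 : IntervalIntegrable (fun t : ℝ ↦ 1 / 2 * (KE ψ T yn t * cexp (((t * (yn + ym) : ℝ) : ℂ) * I)))
      volume T (2 * T) := ((hph (yn + ym)).const_mul _).intervalIntegrable _ _
  have hi2 : IntervalIntegrable (fun t : ℝ ↦ 1 / 2 * (KE ψ T yn t * cexp (((t * (yn - ym) : ℝ) : ℂ) * I)))
      volume T (2 * T) := ((hph (yn - ym)).const_mul _).intervalIntegrable _ _
  have hre := (Complex.reCLM.intervalIntegral_comp_comm (hi1.add hi2))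
  simp only [Complex.reCLM_apply] at hre
  have hhalf : ∀ z : ℂ, ((1 / 2 : ℂ) * z).re = 1 / 2 * z.re := fun z ↦ by
    rw [show (1 / 2 : ℂ) = ((1 / 2 : ℝ) : ℂ) by push_cast; ring, Complex.re_ofReal_mul]
  rw [hre, intervalIntegral.integral_add hi1 hi2, intervalIntegral.integral_const_mul,
    intervalIntegral.integral_const_mul, Complex.add_re, hhalf, hhalf]

/-! ## §P5. Finite sums: bilinearity of `𝓜`, the prime-power index set, Chebyshev inputs, Montgomery–Vaughan -/

/-- `𝓜[Σ_i f_i, w] = Σ_i 𝓜[f_i, w]`. [cite: AlpogeFurman2026, §5.3 (p. 9: "a symmetric bilinear form")] -/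
theorem formB_sum_left (hψ : IsWindow ψ) (T : ℝ) {ι : Type*} (s : Finset ι) (f : ι → ℝ → ℝ)
    (hf : ∀ i, Continuous (f i)) {w : ℝ → ℝ} (hw : Continuous w) :
    formB ψ T (fun τ ↦ ∑ i ∈ s, f i τ) w = ∑ i ∈ s, formB ψ T (f i) w := by
  classical
  induction s using Finset.induction_on with
  | empty => simp [formB]
  | insert a s ha ih =>
    rw [Finset.sum_insert ha, ← ih]
    simp_rw [Finset.sum_insert ha]
    exact formB_add_left hψ T (hf a) (continuous_finsetSum s fun i _ ↦ hf i) hw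

/-- `𝓜[u, Σ_i f_i] = Σ_i 𝓜[u, f_i]`. [cite: AlpogeFurman2026, §5.3 (p. 9: "a symmetric bilinear form")] -/
theorem formB_sum_right (hψ : IsWindow ψ) (T : ℝ) {ι : Type*} (s : Finset ι) (f : ι → ℝ → ℝ)
    (hf : ∀ i, Continuous (f i)) {u : ℝ → ℝ} (hu : Continuous u) :
    formB ψ T u (fun τ ↦ ∑ i ∈ s, f i τ) = ∑ i ∈ s, formB ψ T u (f i) := by
  classical
  induction s using Finset.induction_on with
  | empty => simp [formB]
  | insert a s ha ih =>
    rw [Finset.sum_insert ha, ← ih]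
    simp_rw [Finset.sum_insert ha]
    exact formB_add_right hψ T hu (hf a) (continuous_finsetSum s fun i _ ↦ hf i)

/-- A sum over `range (N+1)` whose `n = 0` term vanishes is the sum over `Icc 1 N`. [folklore] -/
private theorem sum_range_succ_eq_sum_Icc {M : Type*} [AddCommMonoid M] {f : ℕ → M} (N : ℕ)
    (h0 : f 0 = 0) : ∑ n ∈ Finset.range (N + 1), f n = ∑ n ∈ Finset.Icc 1 N, f n := by
  rw [Finset.range_eq_Ico, Finset.Ico_add_one_right_eq_Icc,
    ← Finset.add_sum_Ioc_eq_sum_Icc (Nat.zero_le N), h0, zero_add,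
    show Finset.Icc 1 N = Finset.Ioc 0 N from Finset.Icc_succ_left_eq_Ioc 0 N]

/-- **`P_X` over the prime powers `1 ≤ n ≤ X`**: `P_X(τ) = Σ_{n ∈ [1,⌊X⌋]} (−Λ(n)/(π√n)) cos(τ log n)`
(the `n = 0` term of the defining sum vanishes). [cite: AlpogeFurman2026, §2.1 (pp. 3–4) and Proposition 5.4 (proof: "`P_X(τ) = −(1/2π)Σ_n a_n(n^{iτ}+n^{−iτ})`"), p. 10] -/
theorem primeDensity_eq_sum_Icc (X : ℝ) :
    primeDensity X = fun τ ↦ ∑ n ∈ Finset.Icc 1 ⌊X⌋₊,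
      (-(1 / π) * ((Λ n : ℝ) / Real.sqrt n)) * Real.cos (τ * Real.log n) := by
  funext τ
  rw [primeDensity, Finset.mul_sum, sum_range_succ_eq_sum_Icc _ (by simp [ArithmeticFunction.map_zero])]
  refine Finset.sum_congr rfl fun n _ ↦ ?_
  ring

/-- **Chebyshev inputs on `[1, X]`** (`X = T/2π ≥ 2`, `log X = L`): with `a_n = Λ(n)/√n`,
`Σ a_n ≤ 2(log 4+4)√X`, `Σ a_n² ≤ (log 4+4)·L·X`, `Σ n·a_n² = ΣΛ(n)² ≤ (log 4+4)·L·X`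
(`Λ(n)² ≤ Λ(n) log X`, `ψ(X) ≤ (log 4+4)X`). The printed (5.4): "`Σ_{n≤x}Λ(n)² ≪ x log x`".
[cite: AlpogeFurman2026, Lemma 5.1 eq. (5.4) (p. 7)] -/
theorem chebyshev_inputs {T : ℝ} (hT : 4 * π ≤ T) :
    (∑ n ∈ Finset.Icc 1 ⌊T / (2 * π)⌋₊, (Λ n : ℝ) / Real.sqrt n ≤
        2 * (Real.log 4 + 4) * Real.sqrt (T / (2 * π))) ∧
      (∑ n ∈ Finset.Icc 1 ⌊T / (2 * π)⌋₊, ((Λ n : ℝ) / Real.sqrt n) ^ 2 ≤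
        (Real.log 4 + 4) * logHeight T * (T / (2 * π))) ∧
      (∑ n ∈ Finset.Icc 1 ⌊T / (2 * π)⌋₊, (n : ℝ) * ((Λ n : ℝ) / Real.sqrt n) ^ 2 ≤
        (Real.log 4 + 4) * logHeight T * (T / (2 * π))) := by
  have hπ := Real.pi_gt_three
  set X := T / (2 * π) with hX
  set N := ⌊X⌋₊ with hN
  have hX2 : 2 ≤ X := by rw [hX, le_div_iff₀ (by positivity)]; linarith
  have hX0 : 0 < X := by linarith
  have hlogX : Real.log X = logHeight T := rfl
  have hL0 : 0 ≤ logHeight T := by rw [← hlogX]; exact Real.log_nonneg (by linarith)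
  have hc0 : 0 ≤ Real.log 4 + 4 := by have := Real.log_nonneg (by norm_num : (1:ℝ) ≤ 4); linarith
  -- `Σ_{Icc 1 N} ≤ Σ_{Icc 0 N}` for nonnegative terms
  have hsub : Finset.Icc 1 N ⊆ Finset.Icc 0 N := Finset.Icc_subset_Icc_left (Nat.zero_le 1)
  have h1 : ∑ n ∈ Finset.Icc 1 N, (Λ n : ℝ) / Real.sqrt n ≤ 2 * (Real.log 4 + 4) * Real.sqrt X := by
    refine (Finset.sum_le_sum_of_subset_of_nonneg hsub fun n _ _ ↦
      div_nonneg ArithmeticFunction.vonMangoldt_nonneg (Real.sqrt_nonneg _)).trans ?_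
    exact sum_vonMangoldt_div_sqrt_le hX2
  -- `Λ(n)² / n ≤ Λ(n)²  ≤ Λ(n) · log X` on `[1, N]`, and `n · (Λ/√n)² = Λ²`
  have hkey : ∀ n ∈ Finset.Icc 1 N, (Λ n : ℝ) ^ 2 ≤ (Λ n : ℝ) * Real.log X := by
    intro n hn
    have hn1 : 1 ≤ n := (Finset.mem_Icc.1 hn).1
    have hnN : n ≤ N := (Finset.mem_Icc.1 hn).2
    have hnX : (n : ℝ) ≤ X := (Nat.cast_le.2 hnN).trans (Nat.floor_le hX0.le)
    have hlog : Real.log n ≤ Real.log X := Real.log_le_log (by exact_mod_cast hn1) hnX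
    have hΛ := ArithmeticFunction.vonMangoldt_le_log (n := n)
    rw [sq]
    exact mul_le_mul_of_nonneg_left (hΛ.trans hlog) ArithmeticFunction.vonMangoldt_nonneg
  have hpsi : ∑ n ∈ Finset.Icc 1 N, (Λ n : ℝ) ≤ (Real.log 4 + 4) * X := by
    calc ∑ n ∈ Finset.Icc 1 N, (Λ n : ℝ) ≤ ∑ n ∈ Finset.Icc 0 N, (Λ n : ℝ) :=
          Finset.sum_le_sum_of_subset_of_nonneg hsub fun n _ _ ↦ ArithmeticFunction.vonMangoldt_nonneg
      _ = Chebyshev.psi X := by rw [Chebyshev.psi_eq_sum_Icc]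
      _ ≤ (Real.log 4 + 4) * X := Chebyshev.psi_le_const_mul_self hX0.le
  have hΛsq : ∑ n ∈ Finset.Icc 1 N, (Λ n : ℝ) ^ 2 ≤ (Real.log 4 + 4) * logHeight T * X := by
    calc ∑ n ∈ Finset.Icc 1 N, (Λ n : ℝ) ^ 2 ≤ ∑ n ∈ Finset.Icc 1 N, (Λ n : ℝ) * Real.log X :=
          Finset.sum_le_sum hkey
      _ = Real.log X * ∑ n ∈ Finset.Icc 1 N, (Λ n : ℝ) := by rw [Finset.mul_sum]; simp_rw [mul_comm]
      _ ≤ Real.log X * ((Real.log 4 + 4) * X) := mul_le_mul_of_nonneg_left hpsi (hlogX ▸ hL0)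
      _ = (Real.log 4 + 4) * logHeight T * X := by rw [hlogX]; ring
  have h3 : ∑ n ∈ Finset.Icc 1 N, (n : ℝ) * ((Λ n : ℝ) / Real.sqrt n) ^ 2 =
      ∑ n ∈ Finset.Icc 1 N, (Λ n : ℝ) ^ 2 := by
    refine Finset.sum_congr rfl fun n hn ↦ ?_
    have hn0 : (0 : ℝ) < n := by exact_mod_cast (Finset.mem_Icc.1 hn).1
    rw [div_pow, Real.sq_sqrt hn0.le]
    field_simp
  have h2 : ∑ n ∈ Finset.Icc 1 N, ((Λ n : ℝ) / Real.sqrt n) ^ 2 ≤ ∑ n ∈ Finset.Icc 1 N, (Λ n : ℝ) ^ 2 := by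
    refine Finset.sum_le_sum fun n hn ↦ ?_
    have hn1 : (1 : ℝ) ≤ n := by exact_mod_cast (Finset.mem_Icc.1 hn).1
    rw [div_pow, Real.sq_sqrt (by linarith)]
    exact div_le_self (sq_nonneg _) hn1
  exact ⟨h1, h2.trans hΛsq, h3 ▸ hΛsq⟩

/-- **Montgomery–Vaughan over the prime-power index set `[1, N]`** (the tree's Lemma 2.2 with (2.9),
`AlpogeFurman2026_MV_bilinear_log`, re-indexed): for `x, z : ℕ → ℂ`,
`|Σ_{n≠m∈[1,N]} x_n z_m/(log n − log m)| ≤ 3π (Σ n|x_n|²)^{1/2} (Σ n|z_n|²)^{1/2}`.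
[cite: AlpogeFurman2026, Lemma 2.2 and eq. (2.9) (p. 5)] -/
theorem MV_Icc (N : ℕ) (x z : ℕ → ℂ) :
    ‖∑ n ∈ Finset.Icc 1 N, ∑ m ∈ (Finset.Icc 1 N).erase n,
        x n * z m / ((Real.log n - Real.log m : ℝ) : ℂ)‖ ≤
      3 * π * Real.sqrt (∑ n ∈ Finset.Icc 1 N, (n : ℝ) * ‖x n‖ ^ 2) *
        Real.sqrt (∑ n ∈ Finset.Icc 1 N, (n : ℝ) * ‖z n‖ ^ 2) := by
  classical
  set S := Finset.Icc 1 N with hS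
  have h := AlpogeFurman2026_MV_bilinear_log (ι := ↥S) (fun r ↦ (r : ℕ))
    (fun r ↦ (Finset.mem_Icc.1 r.2).1) (fun r s hrs ↦ Subtype.ext hrs) (fun r ↦ x r)
    (fun r ↦ conj (z r))
  simp only [Complex.conj_conj] at h
  have e1 : ∑ r : ↥S, ∑ s ∈ Finset.univ.erase r,
      x (r : ℕ) * z (s : ℕ) / ((Real.log (r : ℕ) - Real.log (s : ℕ) : ℝ) : ℂ) =
      ∑ n ∈ S, ∑ m ∈ S.erase n, x n * z m / ((Real.log n - Real.log m : ℝ) : ℂ) := by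
    rw [← Finset.sum_coe_sort S]
    refine Finset.sum_congr rfl fun r _ ↦ ?_
    rw [Finset.sum_erase_eq_sub (Finset.mem_univ r), Finset.sum_erase_eq_sub r.2,
      ← Finset.sum_coe_sort S]
  have e2 : ∀ y : ℕ → ℂ, ∑ r : ↥S, ((r : ℕ) : ℝ) * ‖y r‖ ^ 2 = ∑ n ∈ S, (n : ℝ) * ‖y n‖ ^ 2 :=
    fun y ↦ Finset.sum_coe_sort S (fun n ↦ (n : ℝ) * ‖y n‖ ^ 2)
  have e3 : ∑ r : ↥S, ((r : ℕ) : ℝ) * ‖conj (z r)‖ ^ 2 = ∑ n ∈ S, (n : ℝ) * ‖z n‖ ^ 2 := by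
    simp_rw [Complex.norm_conj]; exact e2 z
  rw [e1, e2 x, e3] at h
  exact h

/-- The algebra behind `𝒪₁`: `c_nc_m · (1/(iw))[E₂(α⁻_n + α⁺_m) − E₁(α⁺_n + α⁻_m)]` with the phases
factorised `E₂ = e^{2iTy_n}e^{−2iTy_m}`, `E₁ = e^{iTy_n}e^{−iTy_m}` is `(1/i)·[bilinear]/w`. [folklore] -/
private theorem offdiag_identity (cn cm : ℝ) {w : ℝ} (hw : w ≠ 0)
    (E2p E2m E1p E1m αmn αpm αpn αmm : ℂ) :
    (cn : ℂ) * cm * (1 / ((w : ℂ) * I) * ((E2p * E2m) * (αmn + αpm) - (E1p * E1m) * (αpn + αmm))) =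
      1 / I * ((((cn : ℂ) * E2p * αmn) * (cm * E2m) + ((cn : ℂ) * E2p) * (cm * E2m * αpm)
        - ((cn : ℂ) * E1p * αpn) * (cm * E1m) - ((cn : ℂ) * E1p) * (cm * E1m * αmm)) / (w : ℂ)) := by
  have hI : (I : ℂ) ≠ 0 := Complex.I_ne_zero
  have hw' : (w : ℂ) ≠ 0 := by exact_mod_cast hw
  field_simp
  ring

/-- `√(F²Q)·√Q = F·Q` (`F, Q ≥ 0`). [folklore] -/
private theorem sqrt_mul_sqrt_eq {F Q : ℝ} (hF : 0 ≤ F) (hQ : 0 ≤ Q) :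
    Real.sqrt (F ^ 2 * Q) * Real.sqrt Q = F * Q := by
  rw [Real.sqrt_mul' _ hQ, Real.sqrt_sq hF, mul_assoc, Real.mul_self_sqrt hQ]

/-- **The off-diagonal difference-frequency sum (`𝒪₁`) by Montgomery–Vaughan**: for real weights
`c_n` and `T ≥ 300`, `L ≥ 1`,
`‖Σ_{n≠m∈[1,N]} c_nc_m ∫_I K_{log n}(τ′)e^{iτ′(log n − log m)}dτ′‖ ≤ 12π·∫Φ²·Σ_n n c_n²` — the
printed "each of the four is at most `(3π/2)·πL·Σ_n a_n²/δ_n ≪ L²X`. Hence `|𝒪₁| ≪ L²X`", via the exact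
evaluation `integral_KE_mul_phase` and the tree's Lemma 2.2 (`MV_Icc`).
[cite: AlpogeFurman2026, Proposition 5.4 (proof, the term `𝒪₁`), p. 10] -/
theorem offdiag_le (hψ : IsWindow ψ) {T : ℝ} (hT : 0 < T) (hL : 1 ≤ logHeight T) (N : ℕ) (c : ℕ → ℝ) :
    ‖∑ n ∈ Finset.Icc 1 N, ∑ m ∈ (Finset.Icc 1 N).erase n, (c n : ℂ) * c m *
        ∫ t in T..2 * T, KE ψ T (Real.log n) t * cexp (((t * (Real.log n - Real.log m) : ℝ) : ℂ) * I)‖ ≤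
      12 * π * (∫ x, PhiR ψ T x ^ 2) * ∑ n ∈ Finset.Icc 1 N, (n : ℝ) * c n ^ 2 := by
  classical
  set S := Finset.Icc 1 N with hS
  set F := ∫ x, PhiR ψ T x ^ 2 with hF
  set Q := ∑ n ∈ S, (n : ℝ) * c n ^ 2 with hQ
  have hF0 : 0 ≤ F := integral_nonneg fun x ↦ sq_nonneg _
  have hQ0 : 0 ≤ Q := Finset.sum_nonneg fun n _ ↦ by positivity
  set y : ℕ → ℝ := fun n ↦ Real.log n with hy
  -- the ingredients
  set αp : ℕ → ℂ := fun n ↦ ∫ x in (0 : ℝ)..T, gE ψ T (y n) x with hαp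
  set αm : ℕ → ℂ := fun n ↦ ∫ x in (-T)..0, gE ψ T (y n) x with hαm
  set E2p : ℕ → ℂ := fun n ↦ cexp (((2 * T * y n : ℝ) : ℂ) * I) with hE2p
  set E2m : ℕ → ℂ := fun n ↦ cexp (((-(2 * T * y n) : ℝ) : ℂ) * I) with hE2m
  set E1p : ℕ → ℂ := fun n ↦ cexp (((T * y n : ℝ) : ℂ) * I) with hE1p
  set E1m : ℕ → ℂ := fun n ↦ cexp (((-(T * y n) : ℝ) : ℂ) * I) with hE1m
  have hαp_le : ∀ n, ‖αp n‖ ≤ F := fun n ↦ norm_integral_gE_le hψ hL _ hT.le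
  have hαm_le : ∀ n, ‖αm n‖ ≤ F := fun n ↦ norm_integral_gE_le hψ hL _ (by linarith)
  have hE : ∀ θ : ℝ, ‖cexp (((θ : ℝ) : ℂ) * I)‖ = 1 := fun θ ↦ Complex.norm_exp_ofReal_mul_I θ
  -- the four bilinear families
  set x1 : ℕ → ℂ := fun n ↦ (c n : ℂ) * E2p n * αm n with hx1
  set z1 : ℕ → ℂ := fun m ↦ (c m : ℂ) * E2m m with hz1
  set x2 : ℕ → ℂ := fun n ↦ (c n : ℂ) * E2p n with hx2
  set z2 : ℕ → ℂ := fun m ↦ (c m : ℂ) * E2m m * αp m with hz2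
  set x3 : ℕ → ℂ := fun n ↦ (c n : ℂ) * E1p n * αp n with hx3
  set z3 : ℕ → ℂ := fun m ↦ (c m : ℂ) * E1m m with hz3
  set x4 : ℕ → ℂ := fun n ↦ (c n : ℂ) * E1p n with hx4
  set z4 : ℕ → ℂ := fun m ↦ (c m : ℂ) * E1m m * αm m with hz4
  -- the termwise identity
  have hterm : ∀ n ∈ S, ∀ m ∈ S.erase n, (c n : ℂ) * c m *
      (∫ t in T..2 * T, KE ψ T (Real.log n) t * cexp (((t * (Real.log n - Real.log m) : ℝ) : ℂ) * I)) =
      1 / I * ((x1 n * z1 m + x2 n * z2 m - x3 n * z3 m - x4 n * z4 m) / ((y n - y m : ℝ) : ℂ)) := by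
    intro n hn m hm
    have hn1 : 1 ≤ n := (Finset.mem_Icc.1 hn).1
    have hm1 : 1 ≤ m := (Finset.mem_Icc.1 (Finset.mem_of_mem_erase hm)).1
    have hne : m ≠ n := Finset.ne_of_mem_erase hm
    have hw : y n - y m ≠ 0 := by
      have h := AlpogeFurman2026.Spectral.inv_two_mul_le_abs_log_sub_log hn1 hm1 hne.symm
      intro h0
      rw [hy] at h0; simp only at h0
      rw [h0, abs_zero] at h
      have : (0 : ℝ) < 1 / (2 * (n : ℝ)) := by
        have : (0:ℝ) < n := by exact_mod_cast hn1
        positivity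
      linarith
    have hid := integral_KE_mul_phase hψ hT (y n) hw
    simp only [sub_sub_cancel] at hid
    rw [show (Real.log n - Real.log m : ℝ) = y n - y m from rfl, hid]
    have h2 : cexp (((2 * T * (y n - y m) : ℝ) : ℂ) * I) = E2p n * E2m m := by
      rw [hE2p, hE2m]; dsimp only; rw [← Complex.exp_add]; congr 1; push_cast; ring
    have h1 : cexp (((T * (y n - y m) : ℝ) : ℂ) * I) = E1p n * E1m m := by
      rw [hE1p, hE1m]; dsimp only; rw [← Complex.exp_add]; congr 1; push_cast; ring
    rw [h2, h1]
    exact offdiag_identity (c n) (c m) hw _ _ _ _ _ _ _ _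
  -- sum the identity
  set M1 := ∑ n ∈ S, ∑ m ∈ S.erase n, x1 n * z1 m / ((Real.log n - Real.log m : ℝ) : ℂ) with hM1
  set M2 := ∑ n ∈ S, ∑ m ∈ S.erase n, x2 n * z2 m / ((Real.log n - Real.log m : ℝ) : ℂ) with hM2
  set M3 := ∑ n ∈ S, ∑ m ∈ S.erase n, x3 n * z3 m / ((Real.log n - Real.log m : ℝ) : ℂ) with hM3
  set M4 := ∑ n ∈ S, ∑ m ∈ S.erase n, x4 n * z4 m / ((Real.log n - Real.log m : ℝ) : ℂ) with hM4
  have hsum : ∑ n ∈ S, ∑ m ∈ S.erase n, (c n : ℂ) * c m *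
      (∫ t in T..2 * T, KE ψ T (Real.log n) t * cexp (((t * (Real.log n - Real.log m) : ℝ) : ℂ) * I)) =
      1 / I * (M1 + M2 - M3 - M4) := by
    rw [Finset.sum_congr rfl fun n hn ↦ Finset.sum_congr rfl fun m hm ↦ hterm n hn m hm]
    simp_rw [← Finset.mul_sum]
    congr 1
    have inner : ∀ n ∈ S, ∑ m ∈ S.erase n,
        (x1 n * z1 m + x2 n * z2 m - x3 n * z3 m - x4 n * z4 m) / ((y n - y m : ℝ) : ℂ) =
        (∑ m ∈ S.erase n, x1 n * z1 m / ((Real.log n - Real.log m : ℝ) : ℂ)) +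
          (∑ m ∈ S.erase n, x2 n * z2 m / ((Real.log n - Real.log m : ℝ) : ℂ)) -
          (∑ m ∈ S.erase n, x3 n * z3 m / ((Real.log n - Real.log m : ℝ) : ℂ)) -
          (∑ m ∈ S.erase n, x4 n * z4 m / ((Real.log n - Real.log m : ℝ) : ℂ)) := by
      intro n _
      rw [← Finset.sum_add_distrib, ← Finset.sum_sub_distrib, ← Finset.sum_sub_distrib]
      refine Finset.sum_congr rfl fun m _ ↦ ?_
      rw [show ((y n - y m : ℝ) : ℂ) = ((Real.log n - Real.log m : ℝ) : ℂ) from rfl]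
      ring
    rw [Finset.sum_congr rfl inner, Finset.sum_sub_distrib, Finset.sum_sub_distrib,
      Finset.sum_add_distrib]
  rw [hsum, norm_mul, norm_div, norm_one, Complex.norm_I, div_one, one_mul]
  -- Montgomery–Vaughan for each family
  have hn1 : ∀ n ∈ S, ‖x1 n‖ ^ 2 ≤ F ^ 2 * c n ^ 2 ∧ ‖z1 n‖ ^ 2 = c n ^ 2 ∧ ‖x2 n‖ ^ 2 = c n ^ 2 ∧
      ‖z2 n‖ ^ 2 ≤ F ^ 2 * c n ^ 2 ∧ ‖x3 n‖ ^ 2 ≤ F ^ 2 * c n ^ 2 ∧ ‖z3 n‖ ^ 2 = c n ^ 2 ∧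
      ‖x4 n‖ ^ 2 = c n ^ 2 ∧ ‖z4 n‖ ^ 2 ≤ F ^ 2 * c n ^ 2 := by
    intro n _
    have hc : ‖(c n : ℂ)‖ ^ 2 = c n ^ 2 := by rw [Complex.norm_real, Real.norm_eq_abs, sq_abs]
    have hxF : ∀ (E α : ℂ), ‖E‖ = 1 → ‖α‖ ≤ F → ‖(c n : ℂ) * E * α‖ ^ 2 ≤ F ^ 2 * c n ^ 2 := by
      intro E α hE1 hα
      rw [norm_mul, norm_mul, hE1, mul_one, mul_pow, hc]
      have : ‖α‖ ^ 2 ≤ F ^ 2 := pow_le_pow_left₀ (norm_nonneg _) hα 2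
      nlinarith [sq_nonneg (c n)]
    have hx1' : ∀ E : ℂ, ‖E‖ = 1 → ‖(c n : ℂ) * E‖ ^ 2 = c n ^ 2 := by
      intro E hE1; rw [norm_mul, hE1, mul_one, hc]
    exact ⟨hxF _ _ (hE _) (hαm_le n), hx1' _ (hE _), hx1' _ (hE _), hxF _ _ (hE _) (hαp_le n),
      hxF _ _ (hE _) (hαp_le n), hx1' _ (hE _), hx1' _ (hE _), hxF _ _ (hE _) (hαm_le n)⟩
  have hMV : ∀ (x z : ℕ → ℂ),
      ((∀ n ∈ S, ‖x n‖ ^ 2 ≤ F ^ 2 * c n ^ 2) ∧ (∀ n ∈ S, ‖z n‖ ^ 2 = c n ^ 2)) ∨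
      ((∀ n ∈ S, ‖x n‖ ^ 2 = c n ^ 2) ∧ (∀ n ∈ S, ‖z n‖ ^ 2 ≤ F ^ 2 * c n ^ 2)) →
      ‖∑ n ∈ S, ∑ m ∈ S.erase n, x n * z m / ((Real.log n - Real.log m : ℝ) : ℂ)‖ ≤ 3 * π * (F * Q) := by
    intro x z hor
    have h := MV_Icc N x z
    rw [← hS] at h
    refine h.trans ?_
    rw [mul_assoc (3 * π)]
    refine mul_le_mul_of_nonneg_left ?_ (by positivity)
    have hle : ∀ v : ℕ → ℂ, (∀ n ∈ S, ‖v n‖ ^ 2 ≤ F ^ 2 * c n ^ 2) →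
        ∑ n ∈ S, (n : ℝ) * ‖v n‖ ^ 2 ≤ F ^ 2 * Q := by
      intro v hv
      rw [hQ, Finset.mul_sum]
      refine Finset.sum_le_sum fun n hn ↦ ?_
      have := hv n hn
      have hn0 : (0 : ℝ) ≤ n := Nat.cast_nonneg n
      nlinarith
    have heq : ∀ v : ℕ → ℂ, (∀ n ∈ S, ‖v n‖ ^ 2 = c n ^ 2) → ∑ n ∈ S, (n : ℝ) * ‖v n‖ ^ 2 = Q := by
      intro v hv
      rw [hQ]; exact Finset.sum_congr rfl fun n hn ↦ by rw [hv n hn]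
    rcases hor with ⟨hx, hz⟩ | ⟨hx, hz⟩
    · rw [heq z hz]
      calc Real.sqrt (∑ n ∈ S, (n : ℝ) * ‖x n‖ ^ 2) * Real.sqrt Q ≤ Real.sqrt (F ^ 2 * Q) * Real.sqrt Q :=
            mul_le_mul_of_nonneg_right (Real.sqrt_le_sqrt (hle x hx)) (Real.sqrt_nonneg _)
        _ = F * Q := sqrt_mul_sqrt_eq hF0 hQ0
    · rw [heq x hx, mul_comm (Real.sqrt Q)]
      calc Real.sqrt (∑ n ∈ S, (n : ℝ) * ‖z n‖ ^ 2) * Real.sqrt Q ≤ Real.sqrt (F ^ 2 * Q) * Real.sqrt Q :=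
            mul_le_mul_of_nonneg_right (Real.sqrt_le_sqrt (hle z hz)) (Real.sqrt_nonneg _)
        _ = F * Q := sqrt_mul_sqrt_eq hF0 hQ0
  have hb1 : ‖M1‖ ≤ 3 * π * (F * Q) :=
    hMV x1 z1 (Or.inl ⟨fun n hn ↦ (hn1 n hn).1, fun n hn ↦ (hn1 n hn).2.1⟩)
  have hb2 : ‖M2‖ ≤ 3 * π * (F * Q) :=
    hMV x2 z2 (Or.inr ⟨fun n hn ↦ (hn1 n hn).2.2.1, fun n hn ↦ (hn1 n hn).2.2.2.1⟩)
  have hb3 : ‖M3‖ ≤ 3 * π * (F * Q) :=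
    hMV x3 z3 (Or.inl ⟨fun n hn ↦ (hn1 n hn).2.2.2.2.1, fun n hn ↦ (hn1 n hn).2.2.2.2.2.1⟩)
  have hb4 : ‖M4‖ ≤ 3 * π * (F * Q) :=
    hMV x4 z4 (Or.inr ⟨fun n hn ↦ (hn1 n hn).2.2.2.2.2.2.1, fun n hn ↦ (hn1 n hn).2.2.2.2.2.2.2⟩)
  calc ‖M1 + M2 - M3 - M4‖ ≤ ‖M1‖ + ‖M2‖ + ‖M3‖ + ‖M4‖ := by
        refine (norm_sub_le _ _).trans (add_le_add ((norm_sub_le _ _).trans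
          (add_le_add (norm_add_le _ _) le_rfl)) le_rfl)
    _ ≤ 3 * π * (F * Q) + 3 * π * (F * Q) + 3 * π * (F * Q) + 3 * π * (F * Q) :=
        add_le_add (add_le_add (add_le_add hb1 hb2) hb3) hb4
    _ = 12 * π * F * Q := by ring

/-! ## §P6. Proposition 5.4 for the typed model -/

/-- The weight `c_n := −Λ(n)/(π√n)` of `cos(τ log n)` in `P_X` (`a_n = Λ(n)n^{−1/2}` as printed).
[cite: AlpogeFurman2026, Proposition 5.4 (proof: "`a_n := Λ(n)n^{−1/2}`"), p. 10] -/
def primeCoeff (n : ℕ) : ℝ := -(1 / π) * ((Λ n : ℝ) / Real.sqrt n)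

/-- `W_n(w) := ∫_I K_{log n}(τ′) e^{iτ′w} dτ′`, the `τ′`-integral at frequency `w` against the kernel of
frequency `log n`. [cite: AlpogeFurman2026, Proposition 5.4 (proof, eq. (5.13)), p. 10] -/
def Wosc (ψ : ℝ → ℝ) (T : ℝ) (n : ℕ) (w : ℝ) : ℂ :=
  ∫ t in T..2 * T, KE ψ T (Real.log n) t * cexp (((t * w : ℝ) : ℂ) * I)

/-- `c_n² = a_n²/π²`, `|c_n| = a_n/π`, and `c_1 = 0`; `c_n ≠ 0 ⇒ n ≥ 2` on `[1, N]`.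
[cite: AlpogeFurman2026, Proposition 5.4 (proof), p. 10] -/
theorem primeCoeff_facts (n : ℕ) :
    primeCoeff n ^ 2 = 1 / π ^ 2 * ((Λ n : ℝ) / Real.sqrt n) ^ 2 ∧
      |primeCoeff n| = 1 / π * ((Λ n : ℝ) / Real.sqrt n) ∧ (1 ≤ n → primeCoeff n ≠ 0 → 2 ≤ n) := by
  have hπ := Real.pi_pos
  have ha0 : 0 ≤ (Λ n : ℝ) / Real.sqrt n :=
    div_nonneg ArithmeticFunction.vonMangoldt_nonneg (Real.sqrt_nonneg _)
  refine ⟨by rw [primeCoeff]; ring, by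
    rw [primeCoeff, abs_mul, abs_neg, abs_of_pos (by positivity), abs_of_nonneg ha0], fun hn1 hcn ↦ ?_⟩
  by_contra h
  have : n = 1 := by omega
  apply hcn
  rw [primeCoeff, this, ArithmeticFunction.vonMangoldt_apply_one]; simp

/-- **(5.13) summed: `𝓜[P_X,P_X]` as the sum-frequency double sum, the diagonal, and the
off-diagonal difference-frequency double sum.** [cite: AlpogeFurman2026, Proposition 5.4 (proof, eq. (5.13): "`=: 𝒟 + 𝒪₁ + 𝒪₂`"), p. 10] -/
theorem prime_term_expansion (hψ : IsWindow ψ) (T X : ℝ) :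
    formB ψ T (primeDensity X) (primeDensity X) =
      (∑ n ∈ Finset.Icc 1 ⌊X⌋₊, ∑ m ∈ Finset.Icc 1 ⌊X⌋₊,
          primeCoeff n * primeCoeff m * (1 / 2 * (Wosc ψ T n (Real.log n + Real.log m)).re)) +
        (∑ n ∈ Finset.Icc 1 ⌊X⌋₊,
          primeCoeff n * primeCoeff n * (1 / 2 * (Wosc ψ T n (Real.log n - Real.log n)).re)) +
        ∑ n ∈ Finset.Icc 1 ⌊X⌋₊, ∑ m ∈ (Finset.Icc 1 ⌊X⌋₊).erase n,
          primeCoeff n * primeCoeff m * (1 / 2 * (Wosc ψ T n (Real.log n - Real.log m)).re) := by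
  classical
  set S := Finset.Icc 1 ⌊X⌋₊ with hS
  set c := primeCoeff with hc
  have hP : primeDensity X = fun τ ↦ ∑ n ∈ S, c n * Real.cos (τ * Real.log n) := by
    rw [primeDensity_eq_sum_Icc X]; rfl
  have hcos : ∀ n : ℕ, Continuous fun τ : ℝ ↦ Real.cos (τ * Real.log n) := fun n ↦ by fun_prop
  have hccos : ∀ n : ℕ, Continuous fun τ : ℝ ↦ c n * Real.cos (τ * Real.log n) :=
    fun n ↦ continuous_const.mul (hcos n)
  have e1 : formB ψ T (primeDensity X) (primeDensity X) =
      ∑ n ∈ S, ∑ m ∈ S, c n * c m * (1 / 2 * (Wosc ψ T n (Real.log n + Real.log m)).re +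
        1 / 2 * (Wosc ψ T n (Real.log n - Real.log m)).re) := by
    rw [hP, formB_sum_left hψ T S (fun n τ ↦ c n * Real.cos (τ * Real.log n)) hccos
      (continuous_finsetSum S fun m _ ↦ hccos m)]
    refine Finset.sum_congr rfl fun n _ ↦ ?_
    have h1 : formB ψ T (fun τ ↦ c n * Real.cos (τ * Real.log n))
        (fun τ ↦ ∑ m ∈ S, c m * Real.cos (τ * Real.log m)) =
        c n * formB ψ T (fun τ ↦ Real.cos (τ * Real.log n))
          (fun τ ↦ ∑ m ∈ S, c m * Real.cos (τ * Real.log m)) :=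
      formB_const_mul_left ψ T (c n) _ _
    rw [h1, formB_sum_right hψ T S (fun m τ ↦ c m * Real.cos (τ * Real.log m)) hccos (hcos n),
      Finset.mul_sum]
    refine Finset.sum_congr rfl fun m _ ↦ ?_
    have h2 : formB ψ T (fun τ ↦ Real.cos (τ * Real.log n)) (fun τ ↦ c m * Real.cos (τ * Real.log m)) =
        c m * formB ψ T (fun τ ↦ Real.cos (τ * Real.log n)) (fun τ ↦ Real.cos (τ * Real.log m)) :=
      formB_const_mul_right ψ T (c m) _ _
    rw [h2, formB_cos_cos_eq hψ, Wosc, Wosc]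
    ring
  have h1 : ∀ n ∈ S, ∑ m ∈ S, c n * c m * (1 / 2 * (Wosc ψ T n (Real.log n + Real.log m)).re +
      1 / 2 * (Wosc ψ T n (Real.log n - Real.log m)).re) =
      (∑ m ∈ S, c n * c m * (1 / 2 * (Wosc ψ T n (Real.log n + Real.log m)).re)) +
        (c n * c n * (1 / 2 * (Wosc ψ T n (Real.log n - Real.log n)).re) +
          ∑ m ∈ S.erase n, c n * c m * (1 / 2 * (Wosc ψ T n (Real.log n - Real.log m)).re)) := by
    intro n hn
    rw [Finset.add_sum_erase S (fun m ↦ c n * c m * (1 / 2 * (Wosc ψ T n (Real.log n - Real.log m)).re)) hn,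
      ← Finset.sum_add_distrib]
    refine Finset.sum_congr rfl fun m _ ↦ ?_
    ring
  rw [e1, Finset.sum_congr rfl h1, Finset.sum_add_distrib, Finset.sum_add_distrib, add_assoc]

/-- **The sum-frequency terms (`𝒪₂`)**: `|Σ_{n,m} c_nc_m ½ Re W_n(log n + log m)| ≤ 32·∫Φ²·X`
(`X = T/2π`, `T ≥ 300`): each `W` has frequency `log(nm) ≥ 2 log 2 > 1`, so `|W| ≤ 4∫Φ²`, and
`(Σ|c_n|)² ≤ 16X`. Printed: "`|𝒪₂| ≤ (1/2π²)(Σa_n)²·2πbL·2/log 4 ≪ XL`".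
[cite: AlpogeFurman2026, Proposition 5.4 (proof, the term `𝒪₂`), p. 10] -/
theorem prime_term_sumfreq_le (hψ : IsWindow ψ) {T : ℝ} (hT : 300 ≤ T) (hL : 1 ≤ logHeight T) :
    |∑ n ∈ Finset.Icc 1 ⌊T / (2 * π)⌋₊, ∑ m ∈ Finset.Icc 1 ⌊T / (2 * π)⌋₊,
        primeCoeff n * primeCoeff m * (1 / 2 * (Wosc ψ T n (Real.log n + Real.log m)).re)| ≤
      32 * (∫ x, PhiR ψ T x ^ 2) * (T / (2 * π)) := by
  classical
  have hπ := Real.pi_gt_three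
  have hπ4 := Real.pi_lt_d2
  set X := T / (2 * π) with hX
  set S := Finset.Icc 1 ⌊X⌋₊ with hS
  set F := ∫ x, PhiR ψ T x ^ 2 with hF
  set c := primeCoeff with hc
  set a : ℕ → ℝ := fun n ↦ (Λ n : ℝ) / Real.sqrt n with ha
  have hT0 : 0 < T := by linarith
  have hX0 : 0 < X := by positivity
  have hF0 : 0 ≤ F := integral_nonneg fun x ↦ sq_nonneg _
  have ha0 : ∀ n, 0 ≤ a n := fun n ↦ div_nonneg ArithmeticFunction.vonMangoldt_nonneg (Real.sqrt_nonneg _)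
  have hcabs : ∀ n, |c n| = 1 / π * a n := fun n ↦ (primeCoeff_facts n).2.1
  have hn2 : ∀ n ∈ S, c n ≠ 0 → 2 ≤ n := fun n hn ↦ (primeCoeff_facts n).2.2 (Finset.mem_Icc.1 hn).1
  obtain ⟨hsa, -, -⟩ := chebyshev_inputs (T := T) (by linarith)
  rw [← hX, ← hS] at hsa
  have hlog4 : Real.log 4 ≤ 2 := by
    have h2' : Real.log 4 = 2 * Real.log 2 := by
      rw [show (4 : ℝ) = 2 ^ 2 by norm_num, Real.log_pow]; norm_num
    linarith [Real.log_two_lt_d9]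
  have hsa' : ∑ n ∈ S, a n ≤ 12 * Real.sqrt X := by
    refine hsa.trans ?_; nlinarith [Real.sqrt_nonneg X]
  have hterm : ∀ n ∈ S, ∀ m ∈ S, |c n * c m * (1 / 2 * (Wosc ψ T n (Real.log n + Real.log m)).re)| ≤
      |c n| * |c m| * (2 * F) := by
    intro n hn m hm
    by_cases h0 : c n = 0 ∨ c m = 0
    · rcases h0 with h0 | h0 <;> simp [h0]
    · have h0' := not_or.1 h0
      have hn' := hn2 n hn h0'.1
      have hm' := hn2 m hm h0'.2
      have hw : 1 ≤ Real.log n + Real.log m := by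
        have h2 : Real.log 2 ≤ Real.log n := Real.log_le_log two_pos (by exact_mod_cast hn')
        have h3 : Real.log 2 ≤ Real.log m := Real.log_le_log two_pos (by exact_mod_cast hm')
        linarith [Real.log_two_gt_d9]
      have hW := norm_integral_KE_mul_phase_le hψ hT0 hL (Real.log n) (w := Real.log n + Real.log m)
        (by linarith)
      rw [← hF] at hW
      have hW' : ‖Wosc ψ T n (Real.log n + Real.log m)‖ ≤ 4 * F := by
        rw [Wosc]
        refine hW.trans ?_
        rw [abs_of_pos (by linarith), div_le_iff₀ (by linarith)]
        nlinarith
      rw [abs_mul, abs_mul]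
      refine mul_le_mul_of_nonneg_left ?_ (by positivity)
      rw [abs_mul, abs_of_pos (by norm_num : (0:ℝ) < 1 / 2)]
      have := (Complex.abs_re_le_norm (Wosc ψ T n (Real.log n + Real.log m))).trans hW'
      linarith
  calc |∑ n ∈ S, ∑ m ∈ S, c n * c m * (1 / 2 * (Wosc ψ T n (Real.log n + Real.log m)).re)|
      ≤ ∑ n ∈ S, ∑ m ∈ S, |c n| * |c m| * (2 * F) := by
        refine (Finset.abs_sum_le_sum_abs _ _).trans (Finset.sum_le_sum fun n hn ↦ ?_)
        exact (Finset.abs_sum_le_sum_abs _ _).trans (Finset.sum_le_sum fun m hm ↦ hterm n hn m hm)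
    _ = 2 * F * (∑ n ∈ S, |c n|) ^ 2 := by
        rw [sq, Finset.sum_mul_sum, Finset.mul_sum]
        refine Finset.sum_congr rfl fun n _ ↦ ?_
        rw [Finset.mul_sum]
        refine Finset.sum_congr rfl fun m _ ↦ ?_
        ring
    _ ≤ 2 * F * (4 * Real.sqrt X) ^ 2 := by
        have hsum : ∑ n ∈ S, |c n| ≤ 4 * Real.sqrt X := by
          simp_rw [hcabs]
          rw [← Finset.mul_sum]
          calc 1 / π * ∑ n ∈ S, a n ≤ 1 / 3 * (12 * Real.sqrt X) :=
                mul_le_mul (one_div_le_one_div_of_le (by norm_num) hπ.le) hsa'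
                  (Finset.sum_nonneg fun n _ ↦ ha0 n) (by norm_num)
            _ = 4 * Real.sqrt X := by ring
        have h0 : 0 ≤ ∑ n ∈ S, |c n| := Finset.sum_nonneg fun n _ ↦ abs_nonneg _
        gcongr
    _ = 32 * F * X := by rw [mul_pow, Real.sq_sqrt hX0.le]; ring

/-- **The diagonal (`𝒟`)**: `|Σ_n c_n² ½ Re W_n(0) − (T/π)Σ_n a_n² g(log n)| ≤ (E/18)·Σ_n a_n²` with
`E = 8A²/(3T²) + 4AM` (`|Φ| ≤ ϑ_{M,A}`, `T ≥ 1`), from `re_integral_KE_sub_le`. Printed: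
"`𝒟 = (T/π)Σ_n a_n² g(y_n) + O(L² log L)`". [cite: AlpogeFurman2026, Proposition 5.4 (proof, the term `𝒟`), p. 10] -/
theorem prime_term_diag_le (hψ : IsWindow ψ) {M A : ℝ} (hM : 0 < M) (hA : 0 < A) {T : ℝ}
    (hT : 1 ≤ T) (hL : 1 ≤ logHeight T) (hmaj : ∀ x : ℝ, |PhiR ψ T x| ≤ lorentz M A x) (N : ℕ) :
    |(∑ n ∈ Finset.Icc 1 N, primeCoeff n * primeCoeff n * (1 / 2 * (Wosc ψ T n (Real.log n - Real.log n)).re)) -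
        T / π * ∑ n ∈ Finset.Icc 1 N, ((Λ n : ℝ) / Real.sqrt n) ^ 2 * gConv ψ T (Real.log n)| ≤
      (8 * A ^ 2 / (3 * T ^ 2) + 4 * A * M) / 18 * ∑ n ∈ Finset.Icc 1 N, ((Λ n : ℝ) / Real.sqrt n) ^ 2 := by
  have hπ := Real.pi_gt_three
  set S := Finset.Icc 1 N with hS
  set E := 8 * A ^ 2 / (3 * T ^ 2) + 4 * A * M with hE
  set c := primeCoeff with hc
  set a : ℕ → ℝ := fun n ↦ (Λ n : ℝ) / Real.sqrt n with ha
  have hT0 : 0 < T := by linarith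
  have hE0 : 0 ≤ E := by positivity
  have hc2 : ∀ n, c n ^ 2 = 1 / π ^ 2 * a n ^ 2 := fun n ↦ (primeCoeff_facts n).1
  have hdiag : ∀ n ∈ S, |c n * c n * (1 / 2 * (Wosc ψ T n (Real.log n - Real.log n)).re) -
      T / π * (a n ^ 2 * gConv ψ T (Real.log n))| ≤ c n ^ 2 * (1 / 2 * E) := by
    intro n _
    have hW0 : Wosc ψ T n (Real.log n - Real.log n) = ∫ t in T..2 * T, KE ψ T (Real.log n) t := by
      rw [Wosc]
      refine intervalIntegral.integral_congr fun t _ ↦ ?_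
      simp only [sub_self, mul_zero, Complex.ofReal_zero, zero_mul, Complex.exp_zero, mul_one]
    have hd := re_integral_KE_sub_le hψ hM hA hT hL hmaj (Real.log n)
    rw [← hE] at hd
    have e : c n * c n * (1 / 2 * (Wosc ψ T n (Real.log n - Real.log n)).re) -
        T / π * (a n ^ 2 * gConv ψ T (Real.log n)) =
        c n ^ 2 * (1 / 2 * ((∫ t in T..2 * T, KE ψ T (Real.log n) t).re -
          2 * π * T * gConv ψ T (Real.log n))) := by
      rw [hW0, ← sq, hc2]
      field_simp
    rw [e, abs_mul, abs_of_nonneg (sq_nonneg _), abs_mul, abs_of_pos (by norm_num : (0:ℝ) < 1 / 2)]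
    exact mul_le_mul_of_nonneg_left (mul_le_mul_of_nonneg_left hd (by norm_num)) (sq_nonneg _)
  rw [Finset.mul_sum, ← Finset.sum_sub_distrib]
  calc |∑ n ∈ S, (c n * c n * (1 / 2 * (Wosc ψ T n (Real.log n - Real.log n)).re) -
        T / π * (a n ^ 2 * gConv ψ T (Real.log n)))|
      ≤ ∑ n ∈ S, c n ^ 2 * (1 / 2 * E) :=
        (Finset.abs_sum_le_sum_abs _ _).trans (Finset.sum_le_sum hdiag)
    _ = 1 / 2 * E * (1 / π ^ 2) * ∑ n ∈ S, a n ^ 2 := by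
        rw [Finset.mul_sum]; refine Finset.sum_congr rfl fun n _ ↦ ?_; rw [hc2]; ring
    _ ≤ 1 / 2 * E * (1 / 9) * ∑ n ∈ S, a n ^ 2 := by
        have h9 : 1 / π ^ 2 ≤ 1 / 9 := one_div_le_one_div_of_le (by norm_num) (by nlinarith)
        have h0 : 0 ≤ ∑ n ∈ S, a n ^ 2 := Finset.sum_nonneg fun n _ ↦ sq_nonneg _
        exact mul_le_mul_of_nonneg_right (mul_le_mul_of_nonneg_left h9 (by positivity)) h0
    _ = E / 18 * ∑ n ∈ S, a n ^ 2 := by ring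

/-- **The off-diagonal difference-frequency terms (`𝒪₁`)**:
`|Σ_{n≠m} c_nc_m ½ Re W_n(log n − log m)| ≤ 6π·∫Φ²·Σ_n n c_n²` (`offdiag_le`).
[cite: AlpogeFurman2026, Proposition 5.4 (proof, the term `𝒪₁`), p. 10] -/
theorem prime_term_offdiag_le (hψ : IsWindow ψ) {T : ℝ} (hT : 0 < T) (hL : 1 ≤ logHeight T) (N : ℕ) :
    |∑ n ∈ Finset.Icc 1 N, ∑ m ∈ (Finset.Icc 1 N).erase n,
        primeCoeff n * primeCoeff m * (1 / 2 * (Wosc ψ T n (Real.log n - Real.log m)).re)| ≤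
      6 * π * (∫ x, PhiR ψ T x ^ 2) * ∑ n ∈ Finset.Icc 1 N, (n : ℝ) * primeCoeff n ^ 2 := by
  classical
  set S := Finset.Icc 1 N with hS
  set c := primeCoeff with hc
  have key : ∀ n m : ℕ, ((c n : ℂ) * (c m) * Wosc ψ T n (Real.log n - Real.log m)).re =
      c n * c m * (Wosc ψ T n (Real.log n - Real.log m)).re := fun n m ↦ by
    rw [← Complex.ofReal_mul, Complex.re_ofReal_mul]
  have ere : ∑ n ∈ S, ∑ m ∈ S.erase n, c n * c m * (1 / 2 * (Wosc ψ T n (Real.log n - Real.log m)).re) =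
      1 / 2 * (∑ n ∈ S, ∑ m ∈ S.erase n, (c n : ℂ) * c m * Wosc ψ T n (Real.log n - Real.log m)).re := by
    rw [Complex.re_sum]
    simp_rw [Complex.re_sum, key]
    rw [Finset.mul_sum]
    refine Finset.sum_congr rfl fun n _ ↦ ?_
    rw [Finset.mul_sum]
    refine Finset.sum_congr rfl fun m _ ↦ ?_
    ring
  rw [ere, abs_mul, abs_of_pos (by norm_num : (0:ℝ) < 1 / 2)]
  have h := offdiag_le hψ hT hL N c
  have h' := (Complex.abs_re_le_norm _).trans h
  have h0 : 0 ≤ (∫ x, PhiR ψ T x ^ 2) * ∑ n ∈ S, (n : ℝ) * c n ^ 2 :=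
    mul_nonneg (integral_nonneg fun x ↦ sq_nonneg _) (Finset.sum_nonneg fun n _ ↦ by positivity)
  calc 1 / 2 * |(∑ n ∈ S, ∑ m ∈ S.erase n, (c n : ℂ) * c m * Wosc ψ T n (Real.log n - Real.log m)).re|
      ≤ 1 / 2 * (12 * π * (∫ x, PhiR ψ T x ^ 2) * ∑ n ∈ S, (n : ℝ) * c n ^ 2) :=
        mul_le_mul_of_nonneg_left h' (by norm_num)
    _ = 6 * π * (∫ x, PhiR ψ T x ^ 2) * ∑ n ∈ S, (n : ℝ) * c n ^ 2 := by ring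

end AlpogeFurman2026

set_option maxHeartbeats 400000 in
open AlpogeFurman2026 in
/-- **[AF26] Proposition 5.4 (Prime term) for the typed model, to precision `O(TL²)`**: for a window
`ψ` there is `C ≥ 0` with
`|𝓜[P_X,P_X] − (T/π) Σ_{1≤n≤X} (Λ(n)²/n) g(log n)| ≤ C·T·L²` for all `T ≥ 300` with `L ≥ 10`
(`X = T/2π`, `g = φ² ⋆ φ² = gConv`). Printed: "`𝓜[P_X,P_X] = (T/π)Σ_{n≤X}(Λ(n)²/n)g(log n) + O_χ(L²X)`",
with `𝒟` (diagonal, via (5.12)), `𝒪₂` (sum frequencies, trivially) and `𝒪₁` (difference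
frequencies, by Montgomery–Vaughan) — followed here term by term: `prime_term_expansion` (5.13),
`prime_term_diag_le` (`𝒟`), `prime_term_sumfreq_le` (`𝒪₂`), `prime_term_offdiag_le` (`𝒪₁`), and the
Chebyshev inputs `Σ_{n≤X}a_n² ≤ 6LX`, `Σ_{n≤X}Λ(n)² ≤ 6LX`.
[cite: AlpogeFurman2026, Proposition 5.4 (p. 10)] -/
theorem AlpogeFurman2026_prime_term {ψ : ℝ → ℝ} (hψ : IsWindow ψ) :
    ∃ C : ℝ, 0 ≤ C ∧ ∀ T : ℝ, 300 ≤ T → 10 ≤ logHeight T →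
      |formB ψ T (primeDensity (T / (2 * π))) (primeDensity (T / (2 * π))) -
          T / π * ∑ n ∈ Finset.Icc 1 ⌊T / (2 * π)⌋₊,
            ((Λ n : ℝ) / Real.sqrt n) ^ 2 * gConv ψ T (Real.log n)| ≤ C * T * logHeight T ^ 2 := by
  classical
  obtain ⟨A₀, A₂, hA₀, hA₂, hmaj⟩ := exists_majorant hψ
  obtain ⟨m₀, B, K, -, hB0, -, -, hB, -⟩ := hψ.exists_bounds
  have hπ := Real.pi_gt_three
  have hπ4 := Real.pi_lt_d2
  refine ⟨146 * 13 * B ^ 4 + A₂ ^ 2 + 2 * A₂ * A₀, by positivity, fun T hT hL ↦ ?_⟩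
  set L := logHeight T with hLdef
  set X := T / (2 * π) with hX
  set N := ⌊X⌋₊ with hN
  set S := Finset.Icc 1 N with hS
  have hT0 : 0 < T := by linarith
  have hT1 : 1 ≤ T := by linarith
  have hL1 : 1 ≤ L := by linarith
  have hX0 : 0 < X := by positivity
  have hXT : X ≤ T := by rw [hX, div_le_iff₀ (by positivity)]; nlinarith
  have hMpos : 0 < A₀ * L := by positivity
  have hmajΦ : ∀ x : ℝ, |PhiR ψ T x| ≤ lorentz (A₀ * L) A₂ x := fun x ↦ (hmaj T hL1 x).2
  set F := ∫ x, PhiR ψ T x ^ 2 with hFdef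
  obtain ⟨hFle, -⟩ := integral_PhiR_sq_le hψ hB (T := T) (by linarith)
  rw [← hLdef, ← hFdef] at hFle
  have hF0 : 0 ≤ F := integral_nonneg fun x ↦ sq_nonneg _
  have hlog4 : Real.log 4 ≤ 2 := by
    have h2' : Real.log 4 = 2 * Real.log 2 := by
      rw [show (4 : ℝ) = 2 ^ 2 by norm_num, Real.log_pow]; norm_num
    linarith [Real.log_two_lt_d9]
  -- Chebyshev inputs
  obtain ⟨-, hsa2, hsna2⟩ := chebyshev_inputs (T := T) (by linarith)
  rw [← hLdef] at hsa2 hsna2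
  have hLX0 : 0 ≤ L * X := mul_nonneg (by linarith) hX0.le
  have hcheb6 : (Real.log 4 + 4) * L * X ≤ 6 * L * X := by
    have := mul_le_mul_of_nonneg_right (show Real.log 4 + 4 ≤ 6 by linarith) hLX0
    linarith [show (Real.log 4 + 4) * L * X = (Real.log 4 + 4) * (L * X) by ring,
      show (6 : ℝ) * L * X = 6 * (L * X) by ring]
  have hsa2' : ∑ n ∈ S, ((Λ n : ℝ) / Real.sqrt n) ^ 2 ≤ 6 * L * X := hsa2.trans hcheb6
  have hsna2' : ∑ n ∈ S, (n : ℝ) * primeCoeff n ^ 2 ≤ 6 * L * X := by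
    have h1 : ∑ n ∈ S, (n : ℝ) * primeCoeff n ^ 2 ≤ ∑ n ∈ S, (n : ℝ) * ((Λ n : ℝ) / Real.sqrt n) ^ 2 := by
      refine Finset.sum_le_sum fun n _ ↦ ?_
      rw [(primeCoeff_facts n).1]
      have hπ2 : 1 / π ^ 2 ≤ 1 := by
        rw [div_le_one (by positivity)]; nlinarith
      have hn0 : (0 : ℝ) ≤ n := Nat.cast_nonneg n
      have ha2 : 0 ≤ (n : ℝ) * ((Λ n : ℝ) / Real.sqrt n) ^ 2 := mul_nonneg hn0 (sq_nonneg _)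
      have := mul_le_mul_of_nonneg_right hπ2 ha2
      linarith [show (n : ℝ) * (1 / π ^ 2 * ((Λ n : ℝ) / Real.sqrt n) ^ 2) =
        1 / π ^ 2 * ((n : ℝ) * ((Λ n : ℝ) / Real.sqrt n) ^ 2) by ring]
    exact h1.trans (hsna2.trans hcheb6)
  -- the three pieces
  have h1 := prime_term_sumfreq_le hψ hT hL1
  have h2 := prime_term_diag_le hψ hMpos hA₂ hT1 hL1 hmajΦ N
  have h3 := prime_term_offdiag_le hψ hT0 hL1 N
  rw [← hX, ← hN, ← hS, ← hFdef] at h1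
  rw [← hS, ← hFdef] at h3
  rw [← hS] at h2
  rw [prime_term_expansion hψ T X, ← hN, ← hS]
  -- bounds for the pieces in the common currency `T L²`
  have hB4 : 0 ≤ B ^ 4 := by positivity
  have hLX : L * X ≤ T * L ^ 2 := by nlinarith [mul_nonneg (by linarith : (0:ℝ) ≤ L) hX0.le]
  have hLL : L ≤ L ^ 2 := by nlinarith
  have hBTL : 13 * B ^ 4 * L * T ≤ 13 * B ^ 4 * T * L ^ 2 := by
    have := mul_le_mul_of_nonneg_left hLL (by positivity : (0:ℝ) ≤ 13 * B ^ 4 * T)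
    linarith [show 13 * B ^ 4 * L * T = 13 * B ^ 4 * T * L by ring]
  have hFX : F * X ≤ 13 * B ^ 4 * T * L ^ 2 :=
    (mul_le_mul hFle hXT hX0.le (by positivity)).trans hBTL
  have hb1 : 32 * F * X ≤ 32 * 13 * B ^ 4 * T * L ^ 2 := by linarith
  have hE : (8 * A₂ ^ 2 / (3 * T ^ 2) + 4 * A₂ * (A₀ * L)) / 18 * ∑ n ∈ S, ((Λ n : ℝ) / Real.sqrt n) ^ 2 ≤
      (A₂ ^ 2 + 2 * A₂ * A₀) * T * L ^ 2 := by
    have hT2 : 1 ≤ T ^ 2 := by nlinarith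
    have hE1 : 8 * A₂ ^ 2 / (3 * T ^ 2) ≤ 3 * A₂ ^ 2 := by
      rw [div_le_iff₀ (by positivity)]
      have := mul_le_mul_of_nonneg_left hT2 (sq_nonneg A₂)
      linarith [sq_nonneg A₂, show 3 * A₂ ^ 2 * (3 * T ^ 2) = 9 * (A₂ ^ 2 * T ^ 2) by ring]
    have hEle : 8 * A₂ ^ 2 / (3 * T ^ 2) + 4 * A₂ * (A₀ * L) ≤ (3 * A₂ ^ 2 + 4 * A₂ * A₀) * L := by
      have := mul_le_mul_of_nonneg_left hL1 (sq_nonneg A₂)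
      linarith [show (3 * A₂ ^ 2 + 4 * A₂ * A₀) * L = 3 * (A₂ ^ 2 * L) + 4 * A₂ * (A₀ * L) by ring]
    have hE0 : 0 ≤ 8 * A₂ ^ 2 / (3 * T ^ 2) + 4 * A₂ * (A₀ * L) := by positivity
    have h0 : 0 ≤ ∑ n ∈ S, ((Λ n : ℝ) / Real.sqrt n) ^ 2 := Finset.sum_nonneg fun n _ ↦ sq_nonneg _
    calc (8 * A₂ ^ 2 / (3 * T ^ 2) + 4 * A₂ * (A₀ * L)) / 18 * ∑ n ∈ S, ((Λ n : ℝ) / Real.sqrt n) ^ 2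
        ≤ ((3 * A₂ ^ 2 + 4 * A₂ * A₀) * L) / 18 * (6 * L * X) := by
          refine mul_le_mul (div_le_div_of_nonneg_right hEle (by norm_num)) hsa2' h0 (by positivity)
      _ = (3 * A₂ ^ 2 + 4 * A₂ * A₀) / 3 * (L * (L * X)) := by ring
      _ ≤ (3 * A₂ ^ 2 + 4 * A₂ * A₀) / 3 * (L * (T * L)) := by
          have : L * X ≤ T * L := by
            have := mul_le_mul_of_nonneg_left hXT (by linarith : (0:ℝ) ≤ L)
            linarith [show T * L = L * T by ring]
          have h34 : 0 ≤ (3 * A₂ ^ 2 + 4 * A₂ * A₀) / 3 := by positivity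
          exact mul_le_mul_of_nonneg_left (mul_le_mul_of_nonneg_left this (by linarith)) h34
      _ ≤ (A₂ ^ 2 + 2 * A₂ * A₀) * T * L ^ 2 := by
          have h35 : (3 * A₂ ^ 2 + 4 * A₂ * A₀) / 3 ≤ A₂ ^ 2 + 2 * A₂ * A₀ := by
            rw [div_le_iff₀ (by norm_num)]; nlinarith [mul_pos hA₂ hA₀]
          have hTL : 0 ≤ L * (T * L) := by positivity
          have := mul_le_mul_of_nonneg_right h35 hTL
          linarith [show (A₂ ^ 2 + 2 * A₂ * A₀) * T * L ^ 2 = (A₂ ^ 2 + 2 * A₂ * A₀) * (L * (T * L)) by ring]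
  have hb3 : 6 * π * F * ∑ n ∈ S, (n : ℝ) * primeCoeff n ^ 2 ≤ 114 * 13 * B ^ 4 * T * L ^ 2 := by
    have hLXT : L * X ≤ L * T := mul_le_mul_of_nonneg_left hXT (by linarith)
    have hFLX : F * (L * X) ≤ 13 * B ^ 4 * T * L ^ 2 := by
      have := mul_le_mul hFle hLXT hLX0 (by positivity)
      linarith [show 13 * B ^ 4 * L * (L * T) = 13 * B ^ 4 * T * L ^ 2 by ring]
    have hK0 : 0 ≤ 13 * B ^ 4 * T * L ^ 2 := by positivity
    calc 6 * π * F * ∑ n ∈ S, (n : ℝ) * primeCoeff n ^ 2 ≤ 6 * π * F * (6 * L * X) := by gcongr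
      _ = 36 * π * (F * (L * X)) := by ring
      _ ≤ 36 * 3.15 * (13 * B ^ 4 * T * L ^ 2) := by
          have h0 : 0 ≤ F * (L * X) := by positivity
          have h1 : 36 * π ≤ 36 * 3.15 := by linarith
          exact mul_le_mul h1 hFLX h0 (by norm_num)
      _ ≤ 114 * 13 * B ^ 4 * T * L ^ 2 := by linarith
  have ekey : (∑ n ∈ S, ∑ m ∈ S, primeCoeff n * primeCoeff m * (1 / 2 * (Wosc ψ T n (Real.log n + Real.log m)).re)) +
      (∑ n ∈ S, primeCoeff n * primeCoeff n * (1 / 2 * (Wosc ψ T n (Real.log n - Real.log n)).re)) +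
      (∑ n ∈ S, ∑ m ∈ S.erase n, primeCoeff n * primeCoeff m * (1 / 2 * (Wosc ψ T n (Real.log n - Real.log m)).re)) -
      T / π * ∑ n ∈ S, ((Λ n : ℝ) / Real.sqrt n) ^ 2 * gConv ψ T (Real.log n) =
      (∑ n ∈ S, ∑ m ∈ S, primeCoeff n * primeCoeff m * (1 / 2 * (Wosc ψ T n (Real.log n + Real.log m)).re)) +
      ((∑ n ∈ S, primeCoeff n * primeCoeff n * (1 / 2 * (Wosc ψ T n (Real.log n - Real.log n)).re)) -
        T / π * ∑ n ∈ S, ((Λ n : ℝ) / Real.sqrt n) ^ 2 * gConv ψ T (Real.log n)) +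
      (∑ n ∈ S, ∑ m ∈ S.erase n, primeCoeff n * primeCoeff m * (1 / 2 * (Wosc ψ T n (Real.log n - Real.log m)).re)) := by
    ring
  rw [ekey]
  refine ((abs_add_le _ _).trans (add_le_add (abs_add_le _ _) le_rfl)).trans ?_
  refine (add_le_add (add_le_add h1 h2) h3).trans ?_
  linarith [hb1, hE, hb3]

namespace AlpogeFurman2026

end AlpogeFurman2026

end Literature.NumberTheory.LFunctions

end
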